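import Literature.MathematicalPhysics.KineticTheory.HardSphereMildBBGKYCutoff
import HarnessLib

/-!
# Towards the one-step mild BBGKY hierarchy almost everywhere: the weak identity
(Cercignani–Illner–Pulvirenti 1994 §4.3, Thm 4.3.1, App. 4.B; trunk T-KINETIC, topic
MathematicalPhysics/KineticTheory; continuation of `HardSphereMildBBGKYCutoff`.)

Combining `sum_window_decomposition` with the limits of `HardSphereMildBBGKYCutoff` as the
window length `t/(n+1) → 0`, and then letting the velocity cut-off `V → ∞`:

* `integrable_eventSide_generr`, `sum_fast_le` — integrability of the event-side generic
  error and the bound on the summed fast errors;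
* `cutoff_weak_identity` — for a truncated Gaussian-bounded symmetric weight, the increment over
  `(0, t]` of `∫_{good} 1_{Φ^k_s B}(π Φ_s z₀) W(z₀) dz₀` equals `m` times the sum over the tagged
  labels of the clean flux integrals with velocity cut-off `V`, up to the fast error
  `3 m ∑_i M ∫_{good} 1_{V < 2√(2E)} |W|`;
* `integrable_one_add_norm_vel_mul_exp`, `integrable_fluxDominator` — the Gaussian flux
  dominator without velocity cut-off;
* `weak_identity` — the exact weak one-step identity (no cut-off): the increment equals `m` times
  the sum over the tagged labels `i` of
  `∫ ε^{d-1}(⟪v - v_i, ν⟫)₊ 1_{good}(w) (1_{Φ^k_{τ'}B}(π w) - 1_{Φ^k_{τ'}B}(π w')) W(Φ_{-τ'} w)`,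
  `w = lossConfig Z' i ν v`, `w' = collidePair I L w`, over the collision coordinates with
  `τ' ∈ (0, t]` (CIP 1994 Thm 4.3.1 in weak form, for truncated weights).

## References

* C. Cercignani, R. Illner, M. Pulvirenti, *The Mathematical Theory of Dilute Gases*, Springer
  (1994), §4.3, App. 4.B.
-/

open MeasureTheory MeasureTheory.Measure Metric Real Set Filter Function Topology
open scoped ENNReal InnerProductSpace
open Literature.Analysis.FluidPDE Literature.Analysis

namespace Literature.MathematicalPhysics.KineticTheory

noncomputable section

section Kinetic

variable {d : Type*} [Fintype d]

section Prelim

variable {ε : ℝ} (hε : 0 < ε) (hε' : ε < 2⁻¹)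

include hε hε' in
/-- **The event-side generic error is integrable**: on the single-collision event,
`1_{Genᶜ}(w_out) |W(Φ_{-(a + t₁)} w_out)| = 1_{Genᶜ}(w_out) |W(Φ_{-a} z)| ≤ |W(Φ_{-a} z)|`. [folklore] -/
theorem integrable_eventSide_generr {k m' : ℕ} [NeZero k] (i : Fin k) (a δ V : ℝ)
    {W : Config (k + (m' + 1)) d (UnitAddTorus d) → ℝ} (hW : Measurable W) (hWi : Integrable W)
    (Gen : Set (Config (k + (m' + 1)) d (UnitAddTorus d))) (hGenm : MeasurableSet Gen) :
    Integrable fun z : Config (k + m' + 1) d (UnitAddTorus d) =>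
      (Alexander.singleCollisionEvent (Torus.geometry d) ε (Fin.castAdd 1 (Fin.castAdd m' i)) (Fin.natAdd (k + m') 0) δ).indicator
        (fun z => {z : Config (k + m' + 1) d (UnitAddTorus d) |
            ‖(z (Fin.natAdd (k + m') 0)).2 - (z (Fin.castAdd 1 (Fin.castAdd m' i))).2‖ ≤ V}.indicator
          (fun z => Genᶜ.indicator (1 : Config (k + (m' + 1)) d (UnitAddTorus d) → ℝ)
              (outRep (Torus.geometry d) (k + m') (Fin.castAdd m' i)
                (freeFlight (Torus.geometry d) (Alexander.collisionInstant (Torus.geometry d) ε z 1).toReal z)) *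
            |W (Alexander.regFlow (Torus.geometry d) ε (-(a + (Alexander.collisionInstant (Torus.geometry d) ε z 1).toReal))
              (outRep (Torus.geometry d) (k + m') (Fin.castAdd m' i)
                (freeFlight (Torus.geometry d) (Alexander.collisionInstant (Torus.geometry d) ε z 1).toReal z)))|) z) z := by
  classical
  have hG := Torus.isHardSphereRegular_geometry (d := d) hε'
  have hGm := Torus.isMeasurable_geometry (d := d)
  set I : Fin (k + (m' + 1)) := Fin.castAdd (m' + 1) i with hI
  set L : Fin (k + (m' + 1)) := Fin.natAdd k (Fin.last m') with hL
  set i' : Fin (k + m') := Fin.castAdd m' i with hi'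
  have hI' : (Fin.castAdd 1 i' : Fin (k + m' + 1)) = I := Fin.ext rfl
  have hL' : (Fin.natAdd (k + m') 0 : Fin (k + m' + 1)) = L := Fin.ext (by simp [hL])
  have hIL : I ≠ L := by intro h; have := congrArg Fin.val h; simp [hI, hL] at this; omega
  have houtRep : ∀ w : Config (k + (m' + 1)) d (UnitAddTorus d), outRep (Torus.geometry d) (k + m') i' w = collidePair (Torus.geometry d) I L w := by
    intro w; unfold outRep; rw [hI', hL']
  simp only [hI', hL', houtRep]
  set E := Alexander.singleCollisionEvent (Torus.geometry d) ε I L δ with hE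
  set t₁ : Config (k + (m' + 1)) d (UnitAddTorus d) → ℝ := fun z => (Alexander.collisionInstant (Torus.geometry d) ε z 1).toReal with ht₁
  set cP := collidePair (Torus.geometry d) I L with hcP
  set wout : Config (k + (m' + 1)) d (UnitAddTorus d) → Config (k + (m' + 1)) d (UnitAddTorus d) := fun z => cP (freeFlight (Torus.geometry d) (t₁ z) z) with hwout
  -- measurability
  have ht₁m : Measurable t₁ := (Alexander.measurable_collisionInstant hG hGm 1).ennreal_toReal
  have hcPm : Measurable cP := hGm.measurable_collidePair I L
  have hwoutm : Measurable wout := hcPm.comp (hGm.measurable_freeFlight₂.comp (ht₁m.prodMk measurable_id))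
  have hEm : MeasurableSet E := Alexander.measurableSet_singleCollisionEvent hG hGm (Alexander.measurableSet_good hG hGm) _ _ δ
  have hSlm : MeasurableSet {z : Config (k + m' + 1) d (UnitAddTorus d) | ‖(z L).2 - (z I).2‖ ≤ V} :=
    measurableSet_le (((measurable_pi_apply _).snd.sub (measurable_pi_apply _).snd).norm) measurable_const
  have hRm : Measurable fun z : Config (k + (m' + 1)) d (UnitAddTorus d) => W (Alexander.regFlow (Torus.geometry d) ε (-(a + t₁ z)) (wout z)) := by
    have hin : Measurable fun z : Config (k + (m' + 1)) d (UnitAddTorus d) => ((-(a + t₁ z), wout z) : ℝ × Config (k + (m' + 1)) d (UnitAddTorus d)) := (measurable_const.add ht₁m).neg.prodMk hwoutm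
    have h := (Alexander.measurable_regFlow_uncurry (d := d) (N := k + (m' + 1)) hε').comp hin
    exact hW.comp h
  have hfm : Measurable fun z : Config (k + (m' + 1)) d (UnitAddTorus d) => Genᶜ.indicator (1 : Config (k + (m' + 1)) d (UnitAddTorus d) → ℝ) (wout z) * |W (Alexander.regFlow (Torus.geometry d) ε (-(a + t₁ z)) (wout z))| :=
    ((measurable_const.indicator hGenm.compl).comp hwoutm).mul (continuous_abs.measurable.comp hRm)
  have hWai : Integrable fun z : Config (k + (m' + 1)) d (UnitAddTorus d) => W (Alexander.regFlow (Torus.geometry d) ε (-a) z) :=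
    ((measurePreserving_regFlow_volume hε hε' (-a)).integrable_comp hWi.aestronglyMeasurable).2 hWi
  refine Integrable.mono' hWai.abs ((hfm.indicator hSlm).indicator hEm).aestronglyMeasurable (Filter.Eventually.of_forall fun z => ?_)
  rw [Real.norm_eq_abs]
  by_cases hz : z ∈ E
  · rw [indicator_of_mem hz]
    by_cases hs : ‖(z L).2 - (z I).2‖ ≤ V
    · rw [Set.indicator_apply, if_pos (Set.mem_setOf_eq ▸ hs)]
      have hflow : Alexander.regFlow (Torus.geometry d) ε (t₁ z) z = wout z := regFlow_collisionInstant_eq_of_mem hε' hIL hz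
      have hWa' : W (Alexander.regFlow (Torus.geometry d) ε (-a) z) = W (Alexander.regFlow (Torus.geometry d) ε (-(a + t₁ z)) (wout z)) := by
        rw [← hflow, ← Alexander.regFlow_add hε hε', show -(a + t₁ z) + t₁ z = -a by ring]
      rw [← hWa', abs_mul, abs_abs]
      refine mul_le_of_le_one_left (abs_nonneg _) ?_
      by_cases hg : wout z ∈ Genᶜ
      · rw [indicator_of_mem hg, Pi.one_apply, abs_one]
      · rw [indicator_of_notMem hg, abs_zero]; exact zero_le_one
    · rw [Set.indicator_apply, if_neg (show z ∉ {y : Config (k + m' + 1) d (UnitAddTorus d) | ‖(y L).2 - (y I).2‖ ≤ V} from hs), abs_zero]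
      exact abs_nonneg _
  · rw [indicator_of_notMem hz, abs_zero]; exact abs_nonneg _

include hε hε' in
/-- **The summed fast errors are small for large velocity cut-off**: for a weight supported in
the data with at most `M` instants up to time `Nδ`,
`∑_{j<N} ∫ 1_E 1_{fast} |W ∘ Φ_{-jδ}| ≤ M ∫_{good} 1_{V < 2√(2E)} |W|` (`integral_event_fast_eq`,
`sum_indicator_fast_le`). [folklore] -/
theorem sum_fast_le {k m' : ℕ} (i : Fin k) {δ : ℝ} (hδ : 0 ≤ δ) (N : ℕ) (V : ℝ)
    {W : Config (k + (m' + 1)) d (UnitAddTorus d) → ℝ} (hW : Measurable W) (hWi : Integrable W)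
    {M : ℕ} (hWM : ∀ z, M < Alexander.collisionCount (Torus.geometry d) ε z (N * δ) → W z = 0) :
    ∑ j ∈ Finset.range N, ∫ z, (Alexander.singleCollisionEvent (Torus.geometry d) ε (Fin.castAdd (m' + 1) i) (Fin.natAdd k (Fin.last m')) δ).indicator
            (1 : Config (k + (m' + 1)) d (UnitAddTorus d) → ℝ) z *
          ({z : Config (k + (m' + 1)) d (UnitAddTorus d) | V < ‖(z (Fin.natAdd k (Fin.last m'))).2 - (z (Fin.castAdd (m' + 1) i)).2‖}.indicator (1 : Config (k + (m' + 1)) d (UnitAddTorus d) → ℝ) z *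
            |W (Alexander.regFlow (Torus.geometry d) ε (-(j * δ)) z)|) ≤
      (M : ℝ) * ∫ z₀ in Alexander.good (Torus.geometry d) ε,
        {z : Config (k + (m' + 1)) d (UnitAddTorus d) | V < 2 * Real.sqrt (2 * configEnergy z)}.indicator (1 : Config (k + (m' + 1)) d (UnitAddTorus d) → ℝ) z₀ * |W z₀| := by
  classical
  have hG := Torus.isHardSphereRegular_geometry (d := d) hε'
  have hGm := Torus.isMeasurable_geometry (d := d)
  set I : Fin (k + (m' + 1)) := (Fin.castAdd (m' + 1) i) with hI
  set L : Fin (k + (m' + 1)) := (Fin.natAdd k (Fin.last m')) with hL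
  have hIL : I ≠ L := by intro h; have := congrArg Fin.val h; simp [hI, hL] at this; omega
  set E := Alexander.singleCollisionEvent (Torus.geometry d) ε I L δ with hE
  set Fa : Set (Config (k + (m' + 1)) d (UnitAddTorus d)) := {z | V < ‖(z L).2 - (z I).2‖} with hFa
  set En : Set (Config (k + (m' + 1)) d (UnitAddTorus d)) := {z | V < 2 * Real.sqrt (2 * configEnergy z)} with hEn
  have hEm : MeasurableSet E := Alexander.measurableSet_singleCollisionEvent hG hGm (Alexander.measurableSet_good hG hGm) _ _ δ
  have hFam : MeasurableSet Fa := measurableSet_lt measurable_const (((measurable_pi_apply _).snd.sub (measurable_pi_apply _).snd).norm)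
  have hEnm : MeasurableSet En := measurableSet_lt measurable_const (measurable_const.mul ((measurable_const.mul (measurable_configEnergy' _)).sqrt))
  have hEg : E ⊆ Alexander.good (Torus.geometry d) ε := fun z hz => hz.1
  have hgoodm := Alexander.measurableSet_good (N := k + (m' + 1)) hG hGm
  -- each window in the coordinates of the datum
  have hterm : ∀ j : ℕ, ∫ z, E.indicator (1 : Config (k + (m' + 1)) d (UnitAddTorus d) → ℝ) z * (Fa.indicator (1 : Config (k + (m' + 1)) d (UnitAddTorus d) → ℝ) z * |W (Alexander.regFlow (Torus.geometry d) ε (-(j * δ)) z)|) =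
      ∫ z₀ in Alexander.good (Torus.geometry d) ε, E.indicator (1 : Config (k + (m' + 1)) d (UnitAddTorus d) → ℝ) (Alexander.regFlow (Torus.geometry d) ε (j * δ) z₀) *
        (Fa.indicator (1 : Config (k + (m' + 1)) d (UnitAddTorus d) → ℝ) (Alexander.regFlow (Torus.geometry d) ε (j * δ) z₀) * |W z₀|) := fun j =>
    integral_event_fast_eq hε hε' E Fa hEm hFam hEg hW (j * δ)
  simp_rw [hterm]
  have hind01 : ∀ (S : Set (Config (k + (m' + 1)) d (UnitAddTorus d))) (y : Config (k + (m' + 1)) d (UnitAddTorus d)), 0 ≤ S.indicator (1 : Config (k + (m' + 1)) d (UnitAddTorus d) → ℝ) y ∧ S.indicator (1 : Config (k + (m' + 1)) d (UnitAddTorus d) → ℝ) y ≤ 1 := by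
    intro S y
    by_cases h : y ∈ S
    · rw [indicator_of_mem h, Pi.one_apply]; exact ⟨zero_le_one, le_rfl⟩
    · rw [indicator_of_notMem h]; exact ⟨le_rfl, zero_le_one⟩
  have hti : ∀ j : ℕ, IntegrableOn (fun z₀ => E.indicator (1 : Config (k + (m' + 1)) d (UnitAddTorus d) → ℝ) (Alexander.regFlow (Torus.geometry d) ε (j * δ) z₀) *
      (Fa.indicator (1 : Config (k + (m' + 1)) d (UnitAddTorus d) → ℝ) (Alexander.regFlow (Torus.geometry d) ε (j * δ) z₀) * |W z₀|)) (Alexander.good (Torus.geometry d) ε) := by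
    intro j
    refine Integrable.mono' hWi.integrableOn.abs ?_ (Filter.Eventually.of_forall fun z₀ => ?_)
    · exact (((measurable_const.indicator hEm).comp (Alexander.measurable_regFlow hε' _)).mul
        (((measurable_const.indicator hFam).comp (Alexander.measurable_regFlow hε' _)).mul (continuous_abs.measurable.comp hW))).aestronglyMeasurable
    · have h1 := hind01 E (Alexander.regFlow (Torus.geometry d) ε (j * δ) z₀)
      have h2 := hind01 Fa (Alexander.regFlow (Torus.geometry d) ε (j * δ) z₀)
      rw [Real.norm_eq_abs, abs_mul, abs_mul, abs_abs, abs_of_nonneg h1.1, abs_of_nonneg h2.1]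
      calc _ ≤ 1 * (1 * |W z₀|) := mul_le_mul h1.2 (mul_le_mul_of_nonneg_right h2.2 (abs_nonneg _)) (mul_nonneg h2.1 (abs_nonneg _)) zero_le_one
        _ = |W z₀| := by ring
  rw [← integral_finsetSum _ (fun j _ => hti j), ← integral_const_mul]
  have hEni : IntegrableOn (fun z₀ => (M : ℝ) * (En.indicator (1 : Config (k + (m' + 1)) d (UnitAddTorus d) → ℝ) z₀ * |W z₀|)) (Alexander.good (Torus.geometry d) ε) := by
    refine Integrable.mono' ((hWi.integrableOn.abs).const_mul M) ?_ (Filter.Eventually.of_forall fun z₀ => ?_)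
    · exact (measurable_const.mul ((measurable_const.indicator hEnm).mul (continuous_abs.measurable.comp hW))).aestronglyMeasurable
    · have h1 := hind01 En z₀
      rw [Real.norm_eq_abs, abs_mul, abs_mul, abs_abs, abs_of_nonneg h1.1, Nat.abs_cast]
      exact mul_le_mul_of_nonneg_left (mul_le_of_le_one_left (abs_nonneg _) h1.2) (Nat.cast_nonneg _)
  refine setIntegral_mono_on (integrable_finsetSum _ fun j _ => hti j) hEni hgoodm fun z₀ hz₀ => ?_
  have hre : ∑ j ∈ Finset.range N, E.indicator (1 : Config (k + (m' + 1)) d (UnitAddTorus d) → ℝ) (Alexander.regFlow (Torus.geometry d) ε (j * δ) z₀) *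
      (Fa.indicator (1 : Config (k + (m' + 1)) d (UnitAddTorus d) → ℝ) (Alexander.regFlow (Torus.geometry d) ε (j * δ) z₀) * |W z₀|) =
      (∑ j ∈ Finset.range N, E.indicator (1 : Config (k + (m' + 1)) d (UnitAddTorus d) → ℝ) (Alexander.regFlow (Torus.geometry d) ε (j * δ) z₀) *
        Fa.indicator (1 : Config (k + (m' + 1)) d (UnitAddTorus d) → ℝ) (Alexander.regFlow (Torus.geometry d) ε (j * δ) z₀)) * |W z₀| := by
    rw [Finset.sum_mul]
    refine Finset.sum_congr rfl fun j _ => ?_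
    ring
  rw [hre]
  by_cases hM : Alexander.collisionCount (Torus.geometry d) ε z₀ (N * δ) ≤ M
  · rw [← mul_assoc]
    exact mul_le_mul_of_nonneg_right (sum_indicator_fast_le hε' hIL hz₀ hδ N hM V) (abs_nonneg _)
  · rw [hWM z₀ (not_le.1 hM), abs_zero, mul_zero, mul_zero, mul_zero]

end Prelim

section Weak

variable {ε : ℝ} (hε : 0 < ε) (hε' : ε < 2⁻¹)

set_option maxHeartbeats 4000000 in
include hε hε' in
/-- **The weak one-step identity with velocity cut-off** (CIP 1994 Thm 4.3.1, App. 4.B, before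
letting `V → ∞`). For a measurable set `B` of good tagged configurations, a measurable weight
`W` with a Gaussian bound, symmetric in the untagged labels and supported in the data with at
most `M` collision instants up to time `t > 0`, and a velocity cut-off `V`: the increment over
`(0, t]` of `∫_{good} 1_{Φ^k_s B}(π Φ_s z₀) W(z₀) dz₀` equals `m = m' + 1` times the sum over the
tagged labels `i` of the integrals, over the collision coordinates with absolute collision time
`τ' ∈ (0, t]`, of `ε^{d-1}(⟪v - v_i, ν⟫)₊ 1_{‖v-v_i‖ ≤ V} 1_{good}(w) (1_{Φ^k_{τ'}B}(π w) - 1_{Φ^k_{τ'}B}(π w')) W(Φ_{-τ'} w)`,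
`w = lossConfig`, `w' = collidePair I L w`, up to `3 m ∑_i M ∫_{good} 1_{V < 2√(2E)} |W|`
(`sum_window_decomposition` at window length `t/(n+1)`, `err_le_fast_add_slowgen`,
`flux_windows_sum`, `sum_fast_le`, and the limits `tendsto_window_flux`,
`tendsto_window_slowgen`, `tendsto_dirty` as `n → ∞`). [cite: CIP1994, Thm 4.3.1] -/
theorem cutoff_weak_identity [Nonempty d] [DecidableEq d] {k m' : ℕ} [NeZero k] {t V ρ : ℝ} (ht : 0 < t) (hV : 0 ≤ V)
    (hρ : ρ < 1 / 2) (hερ : ε < ρ)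
    {B : Set (Config k d (UnitAddTorus d))} (hB : MeasurableSet B) (hBg : B ⊆ Alexander.good (Torus.geometry d) ε)
    {W : Config (k + (m' + 1)) d (UnitAddTorus d) → ℝ} (hW : Measurable W)
    (hWσ : ∀ (J : Fin (m' + 1)) (z : Config (k + (m' + 1)) d (UnitAddTorus d)),
      W (z ∘ Equiv.swap (Fin.natAdd k J) (Fin.natAdd k (Fin.last m')) : Config (k + (m' + 1)) d (UnitAddTorus d)) = W z)
    {CW β : ℝ} (hCW : 0 ≤ CW) (hβ : 0 < β) (hWb : ∀ z, |W z| ≤ CW * Real.exp (-β * configEnergy z))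
    {M : ℕ} (hWM : ∀ z, M < Alexander.collisionCount (Torus.geometry d) ε z t → W z = 0) :
    |((∫ z₀ in Alexander.good (Torus.geometry d) ε,
          (Alexander.regFlow (Torus.geometry d) ε (t) '' B).indicator (1 : Config k d (UnitAddTorus d) → ℝ) (Alexander.regFlow (Torus.geometry d) ε (t) z₀ ∘ Fin.castAdd (m' + 1)) * W z₀) -
        ∫ z₀ in Alexander.good (Torus.geometry d) ε, (Alexander.regFlow (Torus.geometry d) ε (0) '' B).indicator (1 : Config k d (UnitAddTorus d) → ℝ) (z₀ ∘ Fin.castAdd (m' + 1)) * W z₀) -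
      (m' + 1 : ℝ) * ∑ i : Fin k, ∫ p, ε ^ (Fintype.card d - 1) * max ⟪p.1.2 - (p.1.1 (Fin.castAdd m' i)).2, (p.2.1 : EuclideanSpace ℝ d)⟫_ℝ 0 *
          {v : EuclideanSpace ℝ d | ‖v - (p.1.1 (Fin.castAdd m' i)).2‖ ≤ V}.indicator (1 : EuclideanSpace ℝ d → ℝ) p.1.2 *
          (Alexander.good (Torus.geometry d) ε).indicator (fun w =>
            ((Alexander.regFlow (Torus.geometry d) ε (p.2.2) '' B).indicator (1 : Config k d (UnitAddTorus d) → ℝ) (w ∘ Fin.castAdd (m' + 1)) -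
              (Alexander.regFlow (Torus.geometry d) ε (p.2.2) '' B).indicator (1 : Config k d (UnitAddTorus d) → ℝ) (collidePair (Torus.geometry d) (Fin.castAdd (m' + 1) i) (Fin.natAdd k (Fin.last m')) w ∘ Fin.castAdd (m' + 1))) *
            W (Alexander.regFlow (Torus.geometry d) ε (-p.2.2) w)) (lossConfig (Torus.geometry d) ε p.1.1 (Fin.castAdd m' i) p.2.1 p.1.2)
        ∂((((volume : Measure (Config (k + m') d (UnitAddTorus d))).prod (volume : Measure (EuclideanSpace ℝ d))).prod ((((volume : Measure (EuclideanSpace ℝ d)).toSphere).prod ((volume : Measure ℝ).restrict (Ioc 0 t))))))| ≤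
      3 * ((m' + 1 : ℝ) * ∑ _i : Fin k, (M : ℝ) * ∫ z₀ in Alexander.good (Torus.geometry d) ε,
        {z : Config (k + (m' + 1)) d (UnitAddTorus d) | V < 2 * Real.sqrt (2 * configEnergy z)}.indicator (1 : Config (k + (m' + 1)) d (UnitAddTorus d) → ℝ) z₀ * |W z₀|) := by
  classical
  haveI : NeZero (k + m') := ⟨by have := NeZero.ne k; omega⟩
  -- integrability of the weight
  have hWi : Integrable W :=
    Integrable.mono' ((integrable_exp_neg_mul_configEnergy hβ).const_mul CW) hW.aestronglyMeasurable
      (Filter.Eventually.of_forall fun z => by rw [Real.norm_eq_abs]; exact hWb z)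
  have hδpos : ∀ n : ℕ, 0 < t / ((n : ℝ) + 1) := fun n => by positivity
  have hNδ : ∀ n : ℕ, ((n + 1 : ℕ) : ℝ) * (t / ((n : ℝ) + 1)) = t := by
    intro n; push_cast; field_simp
  have hδto0 : Tendsto (fun n : ℕ => t / ((n : ℝ) + 1)) atTop (𝓝 0) := by
    have h : Tendsto (fun n : ℕ => (1 : ℝ) / ((n : ℝ) + 1)) atTop (𝓝 0) := tendsto_one_div_add_atTop_nhds_zero_nat
    have h2 := h.const_mul t
    rw [mul_zero] at h2
    refine h2.congr fun n => ?_
    ring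
  -- the limits
  have hBlim : ∀ i : Fin k, Tendsto (fun n : ℕ => ∫ p, ε ^ (Fintype.card d - 1) * max ⟪p.1.2 - (p.1.1 (Fin.castAdd m' i)).2, (p.2.1 : EuclideanSpace ℝ d)⟫_ℝ 0 *
          {v : EuclideanSpace ℝ d | ‖v - (p.1.1 (Fin.castAdd m' i)).2‖ ≤ V}.indicator (1 : EuclideanSpace ℝ d → ℝ) p.1.2 *
          (Alexander.singleCollisionEvent (Torus.geometry d) ε (Fin.castAdd 1 (Fin.castAdd m' i)) (Fin.natAdd (k + m') 0) (t / ((n : ℝ) + 1))).indicator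
            (1 : Config (k + m' + 1) d (UnitAddTorus d) → ℝ)
            (freeFlight (Torus.geometry d) (-(p.2.2 - (t / ((n : ℝ) + 1) * ((⌈p.2.2 / (t / ((n : ℝ) + 1))⌉ : ℤ) - 1 : ℝ)))) (gainConfig (Torus.geometry d) ε p.1.1 (Fin.castAdd m' i) p.2.1 p.1.2)) *
          ({w : Config (k + (m' + 1)) d (UnitAddTorus d) | (w ∘ Fin.castAdd (m' + 1) : Config k d (UnitAddTorus d)) ∈ Alexander.good (Torus.geometry d) ε ∧
            ENNReal.ofReal (t / ((n : ℝ) + 1)) < Alexander.freeExitTime (Torus.geometry d) ε (w ∘ Fin.castAdd (m' + 1) : Config k d (UnitAddTorus d)) ∧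
            (collidePair (Torus.geometry d) (Fin.castAdd (m' + 1) i) (Fin.natAdd k (Fin.last m')) w ∘ Fin.castAdd (m' + 1) : Config k d (UnitAddTorus d)) ∈ Alexander.good (Torus.geometry d) ε ∧
            ENNReal.ofReal (t / ((n : ℝ) + 1)) < Alexander.freeExitTime (Torus.geometry d) ε (flipVel (collidePair (Torus.geometry d) (Fin.castAdd (m' + 1) i) (Fin.natAdd k (Fin.last m')) w ∘ Fin.castAdd (m' + 1) : Config k d (UnitAddTorus d)))}).indicator (fun w =>
            ((Alexander.regFlow (Torus.geometry d) ε (p.2.2) '' B).indicator (1 : Config k d (UnitAddTorus d) → ℝ) (w ∘ Fin.castAdd (m' + 1)) -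
              (Alexander.regFlow (Torus.geometry d) ε (p.2.2) '' B).indicator (1 : Config k d (UnitAddTorus d) → ℝ) (collidePair (Torus.geometry d) (Fin.castAdd (m' + 1) i) (Fin.natAdd k (Fin.last m')) w ∘ Fin.castAdd (m' + 1))) *
            W (Alexander.regFlow (Torus.geometry d) ε (-p.2.2) w)) (lossConfig (Torus.geometry d) ε p.1.1 (Fin.castAdd m' i) p.2.1 p.1.2) ∂((((volume : Measure (Config (k + m') d (UnitAddTorus d))).prod (volume : Measure (EuclideanSpace ℝ d))).prod ((((volume : Measure (EuclideanSpace ℝ d)).toSphere).prod ((volume : Measure ℝ).restrict (Ioc 0 t))))))) atTop (𝓝 (∫ p, ε ^ (Fintype.card d - 1) * max ⟪p.1.2 - (p.1.1 (Fin.castAdd m' i)).2, (p.2.1 : EuclideanSpace ℝ d)⟫_ℝ 0 *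
          {v : EuclideanSpace ℝ d | ‖v - (p.1.1 (Fin.castAdd m' i)).2‖ ≤ V}.indicator (1 : EuclideanSpace ℝ d → ℝ) p.1.2 *
          (Alexander.good (Torus.geometry d) ε).indicator (fun w =>
            ((Alexander.regFlow (Torus.geometry d) ε (p.2.2) '' B).indicator (1 : Config k d (UnitAddTorus d) → ℝ) (w ∘ Fin.castAdd (m' + 1)) -
              (Alexander.regFlow (Torus.geometry d) ε (p.2.2) '' B).indicator (1 : Config k d (UnitAddTorus d) → ℝ) (collidePair (Torus.geometry d) (Fin.castAdd (m' + 1) i) (Fin.natAdd k (Fin.last m')) w ∘ Fin.castAdd (m' + 1))) *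
            W (Alexander.regFlow (Torus.geometry d) ε (-p.2.2) w)) (lossConfig (Torus.geometry d) ε p.1.1 (Fin.castAdd m' i) p.2.1 p.1.2) ∂((((volume : Measure (Config (k + m') d (UnitAddTorus d))).prod (volume : Measure (EuclideanSpace ℝ d))).prod ((((volume : Measure (EuclideanSpace ℝ d)).toSphere).prod ((volume : Measure ℝ).restrict (Ioc 0 t)))))))) := fun i =>
    tendsto_window_flux hε hε' i ht hV hρ hερ hB hW hCW hβ hWb
  have hSlim : ∀ i : Fin k, Tendsto (fun n : ℕ => ∫ p, ε ^ (Fintype.card d - 1) * max ⟪p.1.2 - (p.1.1 (Fin.castAdd m' i)).2, (p.2.1 : EuclideanSpace ℝ d)⟫_ℝ 0 *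
          {v : EuclideanSpace ℝ d | ‖v - (p.1.1 (Fin.castAdd m' i)).2‖ ≤ V}.indicator (1 : EuclideanSpace ℝ d → ℝ) p.1.2 *
          (Alexander.singleCollisionEvent (Torus.geometry d) ε (Fin.castAdd 1 (Fin.castAdd m' i)) (Fin.natAdd (k + m') 0) (t / ((n : ℝ) + 1))).indicator
            (1 : Config (k + m' + 1) d (UnitAddTorus d) → ℝ)
            (freeFlight (Torus.geometry d) (-(p.2.2 - (t / ((n : ℝ) + 1) * ((⌈p.2.2 / (t / ((n : ℝ) + 1))⌉ : ℤ) - 1 : ℝ)))) (gainConfig (Torus.geometry d) ε p.1.1 (Fin.castAdd m' i) p.2.1 p.1.2)) *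
          (({w : Config (k + (m' + 1)) d (UnitAddTorus d) | (w ∘ Fin.castAdd (m' + 1) : Config k d (UnitAddTorus d)) ∈ Alexander.good (Torus.geometry d) ε ∧
            ENNReal.ofReal (t / ((n : ℝ) + 1)) < Alexander.freeExitTime (Torus.geometry d) ε (w ∘ Fin.castAdd (m' + 1) : Config k d (UnitAddTorus d)) ∧
            (collidePair (Torus.geometry d) (Fin.castAdd (m' + 1) i) (Fin.natAdd k (Fin.last m')) w ∘ Fin.castAdd (m' + 1) : Config k d (UnitAddTorus d)) ∈ Alexander.good (Torus.geometry d) ε ∧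
            ENNReal.ofReal (t / ((n : ℝ) + 1)) < Alexander.freeExitTime (Torus.geometry d) ε (flipVel (collidePair (Torus.geometry d) (Fin.castAdd (m' + 1) i) (Fin.natAdd k (Fin.last m')) w ∘ Fin.castAdd (m' + 1) : Config k d (UnitAddTorus d)))})ᶜ.indicator (1 : Config (k + (m' + 1)) d (UnitAddTorus d) → ℝ) (lossConfig (Torus.geometry d) ε p.1.1 (Fin.castAdd m' i) p.2.1 p.1.2) *
            |W (Alexander.regFlow (Torus.geometry d) ε (-p.2.2) (lossConfig (Torus.geometry d) ε p.1.1 (Fin.castAdd m' i) p.2.1 p.1.2))|) ∂((((volume : Measure (Config (k + m') d (UnitAddTorus d))).prod (volume : Measure (EuclideanSpace ℝ d))).prod ((((volume : Measure (EuclideanSpace ℝ d)).toSphere).prod ((volume : Measure ℝ).restrict (Ioc 0 t))))))) atTop (𝓝 0) := fun i =>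
    tendsto_window_slowgen hε hε' i ht hV hρ hερ hW hCW hβ hWb
  have hClim : Tendsto (fun n : ℕ => ∫ z₀ in Alexander.good (Torus.geometry d) ε,
        (∑ j ∈ Finset.range (n + 1), {z₀ : Config (k + (m' + 1)) d (UnitAddTorus d) |
          Alexander.collisionCount (Torus.geometry d) ε z₀ (j * (t / ((n : ℝ) + 1))) + 2 ≤ Alexander.collisionCount (Torus.geometry d) ε z₀ (j * (t / ((n : ℝ) + 1)) + t / ((n : ℝ) + 1))}.indicator
            (1 : Config (k + (m' + 1)) d (UnitAddTorus d) → ℝ) z₀) * |W z₀|) atTop (𝓝 0) := tendsto_dirty hε' ht hW hWi hWM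
  -- the finite-window inequality, for short windows
  have hρε : 0 < ρ - ε := sub_pos.2 hερ
  have hsmall : ∀ᶠ n : ℕ in atTop, t / ((n : ℝ) + 1) * V ≤ ρ - ε := by
    by_cases hV0 : V = 0
    · exact Filter.Eventually.of_forall fun n => by rw [hV0, mul_zero]; exact hρε.le
    · have hVpos : 0 < V := lt_of_le_of_ne hV (Ne.symm hV0)
      filter_upwards [hδto0.eventually (gt_mem_nhds (div_pos hρε hVpos))] with n hn
      rw [← le_div_iff₀ hVpos]; exact hn.le
  have hstep : ∀ᶠ n : ℕ in atTop,
      |((∫ z₀ in Alexander.good (Torus.geometry d) ε,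
          (Alexander.regFlow (Torus.geometry d) ε (t) '' B).indicator (1 : Config k d (UnitAddTorus d) → ℝ) (Alexander.regFlow (Torus.geometry d) ε (t) z₀ ∘ Fin.castAdd (m' + 1)) * W z₀) -
          ∫ z₀ in Alexander.good (Torus.geometry d) ε, (Alexander.regFlow (Torus.geometry d) ε (0) '' B).indicator (1 : Config k d (UnitAddTorus d) → ℝ) (z₀ ∘ Fin.castAdd (m' + 1)) * W z₀) -
        (m' + 1 : ℝ) * ∑ i : Fin k, ∫ p, ε ^ (Fintype.card d - 1) * max ⟪p.1.2 - (p.1.1 (Fin.castAdd m' i)).2, (p.2.1 : EuclideanSpace ℝ d)⟫_ℝ 0 *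
          {v : EuclideanSpace ℝ d | ‖v - (p.1.1 (Fin.castAdd m' i)).2‖ ≤ V}.indicator (1 : EuclideanSpace ℝ d → ℝ) p.1.2 *
          (Alexander.good (Torus.geometry d) ε).indicator (fun w =>
            ((Alexander.regFlow (Torus.geometry d) ε (p.2.2) '' B).indicator (1 : Config k d (UnitAddTorus d) → ℝ) (w ∘ Fin.castAdd (m' + 1)) -
              (Alexander.regFlow (Torus.geometry d) ε (p.2.2) '' B).indicator (1 : Config k d (UnitAddTorus d) → ℝ) (collidePair (Torus.geometry d) (Fin.castAdd (m' + 1) i) (Fin.natAdd k (Fin.last m')) w ∘ Fin.castAdd (m' + 1))) *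
            W (Alexander.regFlow (Torus.geometry d) ε (-p.2.2) w)) (lossConfig (Torus.geometry d) ε p.1.1 (Fin.castAdd m' i) p.2.1 p.1.2)
          ∂((((volume : Measure (Config (k + m') d (UnitAddTorus d))).prod (volume : Measure (EuclideanSpace ℝ d))).prod ((((volume : Measure (EuclideanSpace ℝ d)).toSphere).prod ((volume : Measure ℝ).restrict (Ioc 0 t))))))| ≤
      (2 * (∫ z₀ in Alexander.good (Torus.geometry d) ε,
        (∑ j ∈ Finset.range (n + 1), {z₀ : Config (k + (m' + 1)) d (UnitAddTorus d) |
          Alexander.collisionCount (Torus.geometry d) ε z₀ (j * (t / ((n : ℝ) + 1))) + 2 ≤ Alexander.collisionCount (Torus.geometry d) ε z₀ (j * (t / ((n : ℝ) + 1)) + t / ((n : ℝ) + 1))}.indicator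
            (1 : Config (k + (m' + 1)) d (UnitAddTorus d) → ℝ) z₀) * |W z₀|) +
        (m' + 1 : ℝ) * ∑ i : Fin k, (3 * ((M : ℝ) * ∫ z₀ in Alexander.good (Torus.geometry d) ε,
        {z : Config (k + (m' + 1)) d (UnitAddTorus d) | V < 2 * Real.sqrt (2 * configEnergy z)}.indicator (1 : Config (k + (m' + 1)) d (UnitAddTorus d) → ℝ) z₀ * |W z₀|) + 2 * ∫ p, ε ^ (Fintype.card d - 1) * max ⟪p.1.2 - (p.1.1 (Fin.castAdd m' i)).2, (p.2.1 : EuclideanSpace ℝ d)⟫_ℝ 0 *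
          {v : EuclideanSpace ℝ d | ‖v - (p.1.1 (Fin.castAdd m' i)).2‖ ≤ V}.indicator (1 : EuclideanSpace ℝ d → ℝ) p.1.2 *
          (Alexander.singleCollisionEvent (Torus.geometry d) ε (Fin.castAdd 1 (Fin.castAdd m' i)) (Fin.natAdd (k + m') 0) (t / ((n : ℝ) + 1))).indicator
            (1 : Config (k + m' + 1) d (UnitAddTorus d) → ℝ)
            (freeFlight (Torus.geometry d) (-(p.2.2 - (t / ((n : ℝ) + 1) * ((⌈p.2.2 / (t / ((n : ℝ) + 1))⌉ : ℤ) - 1 : ℝ)))) (gainConfig (Torus.geometry d) ε p.1.1 (Fin.castAdd m' i) p.2.1 p.1.2)) *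
          (({w : Config (k + (m' + 1)) d (UnitAddTorus d) | (w ∘ Fin.castAdd (m' + 1) : Config k d (UnitAddTorus d)) ∈ Alexander.good (Torus.geometry d) ε ∧
            ENNReal.ofReal (t / ((n : ℝ) + 1)) < Alexander.freeExitTime (Torus.geometry d) ε (w ∘ Fin.castAdd (m' + 1) : Config k d (UnitAddTorus d)) ∧
            (collidePair (Torus.geometry d) (Fin.castAdd (m' + 1) i) (Fin.natAdd k (Fin.last m')) w ∘ Fin.castAdd (m' + 1) : Config k d (UnitAddTorus d)) ∈ Alexander.good (Torus.geometry d) ε ∧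
            ENNReal.ofReal (t / ((n : ℝ) + 1)) < Alexander.freeExitTime (Torus.geometry d) ε (flipVel (collidePair (Torus.geometry d) (Fin.castAdd (m' + 1) i) (Fin.natAdd k (Fin.last m')) w ∘ Fin.castAdd (m' + 1) : Config k d (UnitAddTorus d)))})ᶜ.indicator (1 : Config (k + (m' + 1)) d (UnitAddTorus d) → ℝ) (lossConfig (Torus.geometry d) ε p.1.1 (Fin.castAdd m' i) p.2.1 p.1.2) *
            |W (Alexander.regFlow (Torus.geometry d) ε (-p.2.2) (lossConfig (Torus.geometry d) ε p.1.1 (Fin.castAdd m' i) p.2.1 p.1.2))|) ∂((((volume : Measure (Config (k + m') d (UnitAddTorus d))).prod (volume : Measure (EuclideanSpace ℝ d))).prod ((((volume : Measure (EuclideanSpace ℝ d)).toSphere).prod ((volume : Measure ℝ).restrict (Ioc 0 t)))))))) +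
      |(m' + 1 : ℝ) * ∑ i : Fin k, ∫ p, ε ^ (Fintype.card d - 1) * max ⟪p.1.2 - (p.1.1 (Fin.castAdd m' i)).2, (p.2.1 : EuclideanSpace ℝ d)⟫_ℝ 0 *
          {v : EuclideanSpace ℝ d | ‖v - (p.1.1 (Fin.castAdd m' i)).2‖ ≤ V}.indicator (1 : EuclideanSpace ℝ d → ℝ) p.1.2 *
          (Alexander.singleCollisionEvent (Torus.geometry d) ε (Fin.castAdd 1 (Fin.castAdd m' i)) (Fin.natAdd (k + m') 0) (t / ((n : ℝ) + 1))).indicator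
            (1 : Config (k + m' + 1) d (UnitAddTorus d) → ℝ)
            (freeFlight (Torus.geometry d) (-(p.2.2 - (t / ((n : ℝ) + 1) * ((⌈p.2.2 / (t / ((n : ℝ) + 1))⌉ : ℤ) - 1 : ℝ)))) (gainConfig (Torus.geometry d) ε p.1.1 (Fin.castAdd m' i) p.2.1 p.1.2)) *
          ({w : Config (k + (m' + 1)) d (UnitAddTorus d) | (w ∘ Fin.castAdd (m' + 1) : Config k d (UnitAddTorus d)) ∈ Alexander.good (Torus.geometry d) ε ∧
            ENNReal.ofReal (t / ((n : ℝ) + 1)) < Alexander.freeExitTime (Torus.geometry d) ε (w ∘ Fin.castAdd (m' + 1) : Config k d (UnitAddTorus d)) ∧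
            (collidePair (Torus.geometry d) (Fin.castAdd (m' + 1) i) (Fin.natAdd k (Fin.last m')) w ∘ Fin.castAdd (m' + 1) : Config k d (UnitAddTorus d)) ∈ Alexander.good (Torus.geometry d) ε ∧
            ENNReal.ofReal (t / ((n : ℝ) + 1)) < Alexander.freeExitTime (Torus.geometry d) ε (flipVel (collidePair (Torus.geometry d) (Fin.castAdd (m' + 1) i) (Fin.natAdd k (Fin.last m')) w ∘ Fin.castAdd (m' + 1) : Config k d (UnitAddTorus d)))}).indicator (fun w =>
            ((Alexander.regFlow (Torus.geometry d) ε (p.2.2) '' B).indicator (1 : Config k d (UnitAddTorus d) → ℝ) (w ∘ Fin.castAdd (m' + 1)) -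
              (Alexander.regFlow (Torus.geometry d) ε (p.2.2) '' B).indicator (1 : Config k d (UnitAddTorus d) → ℝ) (collidePair (Torus.geometry d) (Fin.castAdd (m' + 1) i) (Fin.natAdd k (Fin.last m')) w ∘ Fin.castAdd (m' + 1))) *
            W (Alexander.regFlow (Torus.geometry d) ε (-p.2.2) w)) (lossConfig (Torus.geometry d) ε p.1.1 (Fin.castAdd m' i) p.2.1 p.1.2) ∂((((volume : Measure (Config (k + m') d (UnitAddTorus d))).prod (volume : Measure (EuclideanSpace ℝ d))).prod ((((volume : Measure (EuclideanSpace ℝ d)).toSphere).prod ((volume : Measure ℝ).restrict (Ioc 0 t)))))) -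
        (m' + 1 : ℝ) * ∑ i : Fin k, ∫ p, ε ^ (Fintype.card d - 1) * max ⟪p.1.2 - (p.1.1 (Fin.castAdd m' i)).2, (p.2.1 : EuclideanSpace ℝ d)⟫_ℝ 0 *
          {v : EuclideanSpace ℝ d | ‖v - (p.1.1 (Fin.castAdd m' i)).2‖ ≤ V}.indicator (1 : EuclideanSpace ℝ d → ℝ) p.1.2 *
          (Alexander.good (Torus.geometry d) ε).indicator (fun w =>
            ((Alexander.regFlow (Torus.geometry d) ε (p.2.2) '' B).indicator (1 : Config k d (UnitAddTorus d) → ℝ) (w ∘ Fin.castAdd (m' + 1)) -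
              (Alexander.regFlow (Torus.geometry d) ε (p.2.2) '' B).indicator (1 : Config k d (UnitAddTorus d) → ℝ) (collidePair (Torus.geometry d) (Fin.castAdd (m' + 1) i) (Fin.natAdd k (Fin.last m')) w ∘ Fin.castAdd (m' + 1))) *
            W (Alexander.regFlow (Torus.geometry d) ε (-p.2.2) w)) (lossConfig (Torus.geometry d) ε p.1.1 (Fin.castAdd m' i) p.2.1 p.1.2) ∂((((volume : Measure (Config (k + m') d (UnitAddTorus d))).prod (volume : Measure (EuclideanSpace ℝ d))).prod ((((volume : Measure (EuclideanSpace ℝ d)).toSphere).prod ((volume : Measure ℝ).restrict (Ioc 0 t))))))| := by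
    filter_upwards [hsmall] with n hn
    have hδV : ε + t / ((n : ℝ) + 1) * V ≤ ρ := by linarith
    -- the window decomposition over `n + 1` windows of length `t / (n + 1)`
    have hwin := sum_window_decomposition hε hε' (k := k) (m' := m') (δ := t / ((n : ℝ) + 1)) (V := V) (ρ := ρ) (hδpos n) (n + 1)
      hρ hδV hB hBg hW hWi hWσ
    rw [hNδ n] at hwin
    -- the cut-off errors of the windows
    have herr : ∀ (i : Fin k) (j : ℕ), ∫ z, (Alexander.singleCollisionEvent (Torus.geometry d) ε (Fin.castAdd (m' + 1) i) (Fin.natAdd k (Fin.last m')) (t / ((n : ℝ) + 1))).indicator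
            (1 : Config (k + (m' + 1)) d (UnitAddTorus d) → ℝ) z *
          (({z : Config (k + (m' + 1)) d (UnitAddTorus d) |
                V < ‖(z (Fin.natAdd k (Fin.last m'))).2 - (z (Fin.castAdd (m' + 1) i)).2‖}.indicator
                (1 : Config (k + (m' + 1)) d (UnitAddTorus d) → ℝ) z +
              2 * ({w : Config (k + (m' + 1)) d (UnitAddTorus d) | (w ∘ Fin.castAdd (m' + 1) : Config k d (UnitAddTorus d)) ∈ Alexander.good (Torus.geometry d) ε ∧
                  ENNReal.ofReal (t / ((n : ℝ) + 1)) < Alexander.freeExitTime (Torus.geometry d) ε (w ∘ Fin.castAdd (m' + 1) : Config k d (UnitAddTorus d)) ∧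
                  (collidePair (Torus.geometry d) (Fin.castAdd (m' + 1) i) (Fin.natAdd k (Fin.last m')) w ∘ Fin.castAdd (m' + 1) : Config k d (UnitAddTorus d)) ∈ Alexander.good (Torus.geometry d) ε ∧
                  ENNReal.ofReal (t / ((n : ℝ) + 1)) < Alexander.freeExitTime (Torus.geometry d) ε (flipVel (collidePair (Torus.geometry d) (Fin.castAdd (m' + 1) i) (Fin.natAdd k (Fin.last m')) w ∘ Fin.castAdd (m' + 1) : Config k d (UnitAddTorus d)))})ᶜ.indicator (1 : Config (k + (m' + 1)) d (UnitAddTorus d) → ℝ)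
                (collidePair (Torus.geometry d) (Fin.castAdd (m' + 1) i) (Fin.natAdd k (Fin.last m'))
                  (freeFlight (Torus.geometry d) (Alexander.collisionInstant (Torus.geometry d) ε z 1).toReal z))) *
            |W (Alexander.regFlow (Torus.geometry d) ε (-(j * (t / ((n : ℝ) + 1)))) z)|) ≤ 3 * (∫ z, (Alexander.singleCollisionEvent (Torus.geometry d) ε (Fin.castAdd (m' + 1) i) (Fin.natAdd k (Fin.last m')) (t / ((n : ℝ) + 1))).indicator
            (1 : Config (k + (m' + 1)) d (UnitAddTorus d) → ℝ) z *
          ({z : Config (k + (m' + 1)) d (UnitAddTorus d) | V < ‖(z (Fin.natAdd k (Fin.last m'))).2 - (z (Fin.castAdd (m' + 1) i)).2‖}.indicator (1 : Config (k + (m' + 1)) d (UnitAddTorus d) → ℝ) z *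
            |W (Alexander.regFlow (Torus.geometry d) ε (-(j * (t / ((n : ℝ) + 1)))) z)|)) + 2 * ∫ p, ε ^ (Fintype.card d - 1) * max ⟪p.1.2 - (p.1.1 (Fin.castAdd m' i)).2, (p.2.1 : EuclideanSpace ℝ d)⟫_ℝ 0 *
          {v : EuclideanSpace ℝ d | ‖v - (p.1.1 (Fin.castAdd m' i)).2‖ ≤ V}.indicator (1 : EuclideanSpace ℝ d → ℝ) p.1.2 *
          (Alexander.singleCollisionEvent (Torus.geometry d) ε (Fin.castAdd 1 (Fin.castAdd m' i)) (Fin.natAdd (k + m') 0) (t / ((n : ℝ) + 1))).indicator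
            (1 : Config (k + m' + 1) d (UnitAddTorus d) → ℝ)
            (freeFlight (Torus.geometry d) (-p.2.2) (gainConfig (Torus.geometry d) ε p.1.1 (Fin.castAdd m' i) p.2.1 p.1.2)) *
          (({w : Config (k + (m' + 1)) d (UnitAddTorus d) | (w ∘ Fin.castAdd (m' + 1) : Config k d (UnitAddTorus d)) ∈ Alexander.good (Torus.geometry d) ε ∧
            ENNReal.ofReal (t / ((n : ℝ) + 1)) < Alexander.freeExitTime (Torus.geometry d) ε (w ∘ Fin.castAdd (m' + 1) : Config k d (UnitAddTorus d)) ∧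
            (collidePair (Torus.geometry d) (Fin.castAdd (m' + 1) i) (Fin.natAdd k (Fin.last m')) w ∘ Fin.castAdd (m' + 1) : Config k d (UnitAddTorus d)) ∈ Alexander.good (Torus.geometry d) ε ∧
            ENNReal.ofReal (t / ((n : ℝ) + 1)) < Alexander.freeExitTime (Torus.geometry d) ε (flipVel (collidePair (Torus.geometry d) (Fin.castAdd (m' + 1) i) (Fin.natAdd k (Fin.last m')) w ∘ Fin.castAdd (m' + 1) : Config k d (UnitAddTorus d)))})ᶜ.indicator (1 : Config (k + (m' + 1)) d (UnitAddTorus d) → ℝ) (lossConfig (Torus.geometry d) ε p.1.1 (Fin.castAdd m' i) p.2.1 p.1.2) *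
            |W (Alexander.regFlow (Torus.geometry d) ε (-(j * (t / ((n : ℝ) + 1)) + p.2.2)) (lossConfig (Torus.geometry d) ε p.1.1 (Fin.castAdd m' i) p.2.1 p.1.2))|) ∂((((volume : Measure (Config (k + m') d (UnitAddTorus d))).prod (volume : Measure (EuclideanSpace ℝ d))).prod ((((volume : Measure (EuclideanSpace ℝ d)).toSphere).prod ((volume : Measure ℝ).restrict (Ioc 0 (t / ((n : ℝ) + 1)))))))) := fun i j =>
      err_le_fast_add_slowgen hε hε' i (a := j * (t / ((n : ℝ) + 1))) hρ hδV hW hWi _ (measurableSet_gen hε' _ _ _)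
    -- the slow generic errors summed over the windows
    have hsg : ∀ i : Fin k, ∑ j ∈ Finset.range (n + 1), ∫ p, ε ^ (Fintype.card d - 1) * max ⟪p.1.2 - (p.1.1 (Fin.castAdd m' i)).2, (p.2.1 : EuclideanSpace ℝ d)⟫_ℝ 0 *
          {v : EuclideanSpace ℝ d | ‖v - (p.1.1 (Fin.castAdd m' i)).2‖ ≤ V}.indicator (1 : EuclideanSpace ℝ d → ℝ) p.1.2 *
          (Alexander.singleCollisionEvent (Torus.geometry d) ε (Fin.castAdd 1 (Fin.castAdd m' i)) (Fin.natAdd (k + m') 0) (t / ((n : ℝ) + 1))).indicator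
            (1 : Config (k + m' + 1) d (UnitAddTorus d) → ℝ)
            (freeFlight (Torus.geometry d) (-p.2.2) (gainConfig (Torus.geometry d) ε p.1.1 (Fin.castAdd m' i) p.2.1 p.1.2)) *
          (({w : Config (k + (m' + 1)) d (UnitAddTorus d) | (w ∘ Fin.castAdd (m' + 1) : Config k d (UnitAddTorus d)) ∈ Alexander.good (Torus.geometry d) ε ∧
            ENNReal.ofReal (t / ((n : ℝ) + 1)) < Alexander.freeExitTime (Torus.geometry d) ε (w ∘ Fin.castAdd (m' + 1) : Config k d (UnitAddTorus d)) ∧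
            (collidePair (Torus.geometry d) (Fin.castAdd (m' + 1) i) (Fin.natAdd k (Fin.last m')) w ∘ Fin.castAdd (m' + 1) : Config k d (UnitAddTorus d)) ∈ Alexander.good (Torus.geometry d) ε ∧
            ENNReal.ofReal (t / ((n : ℝ) + 1)) < Alexander.freeExitTime (Torus.geometry d) ε (flipVel (collidePair (Torus.geometry d) (Fin.castAdd (m' + 1) i) (Fin.natAdd k (Fin.last m')) w ∘ Fin.castAdd (m' + 1) : Config k d (UnitAddTorus d)))})ᶜ.indicator (1 : Config (k + (m' + 1)) d (UnitAddTorus d) → ℝ) (lossConfig (Torus.geometry d) ε p.1.1 (Fin.castAdd m' i) p.2.1 p.1.2) *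
            |W (Alexander.regFlow (Torus.geometry d) ε (-(j * (t / ((n : ℝ) + 1)) + p.2.2)) (lossConfig (Torus.geometry d) ε p.1.1 (Fin.castAdd m' i) p.2.1 p.1.2))|) ∂((((volume : Measure (Config (k + m') d (UnitAddTorus d))).prod (volume : Measure (EuclideanSpace ℝ d))).prod ((((volume : Measure (EuclideanSpace ℝ d)).toSphere).prod ((volume : Measure ℝ).restrict (Ioc 0 (t / ((n : ℝ) + 1)))))))) = ∫ p, ε ^ (Fintype.card d - 1) * max ⟪p.1.2 - (p.1.1 (Fin.castAdd m' i)).2, (p.2.1 : EuclideanSpace ℝ d)⟫_ℝ 0 *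
          {v : EuclideanSpace ℝ d | ‖v - (p.1.1 (Fin.castAdd m' i)).2‖ ≤ V}.indicator (1 : EuclideanSpace ℝ d → ℝ) p.1.2 *
          (Alexander.singleCollisionEvent (Torus.geometry d) ε (Fin.castAdd 1 (Fin.castAdd m' i)) (Fin.natAdd (k + m') 0) (t / ((n : ℝ) + 1))).indicator
            (1 : Config (k + m' + 1) d (UnitAddTorus d) → ℝ)
            (freeFlight (Torus.geometry d) (-(p.2.2 - (t / ((n : ℝ) + 1) * ((⌈p.2.2 / (t / ((n : ℝ) + 1))⌉ : ℤ) - 1 : ℝ)))) (gainConfig (Torus.geometry d) ε p.1.1 (Fin.castAdd m' i) p.2.1 p.1.2)) *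
          (({w : Config (k + (m' + 1)) d (UnitAddTorus d) | (w ∘ Fin.castAdd (m' + 1) : Config k d (UnitAddTorus d)) ∈ Alexander.good (Torus.geometry d) ε ∧
            ENNReal.ofReal (t / ((n : ℝ) + 1)) < Alexander.freeExitTime (Torus.geometry d) ε (w ∘ Fin.castAdd (m' + 1) : Config k d (UnitAddTorus d)) ∧
            (collidePair (Torus.geometry d) (Fin.castAdd (m' + 1) i) (Fin.natAdd k (Fin.last m')) w ∘ Fin.castAdd (m' + 1) : Config k d (UnitAddTorus d)) ∈ Alexander.good (Torus.geometry d) ε ∧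
            ENNReal.ofReal (t / ((n : ℝ) + 1)) < Alexander.freeExitTime (Torus.geometry d) ε (flipVel (collidePair (Torus.geometry d) (Fin.castAdd (m' + 1) i) (Fin.natAdd k (Fin.last m')) w ∘ Fin.castAdd (m' + 1) : Config k d (UnitAddTorus d)))})ᶜ.indicator (1 : Config (k + (m' + 1)) d (UnitAddTorus d) → ℝ) (lossConfig (Torus.geometry d) ε p.1.1 (Fin.castAdd m' i) p.2.1 p.1.2) *
            |W (Alexander.regFlow (Torus.geometry d) ε (-p.2.2) (lossConfig (Torus.geometry d) ε p.1.1 (Fin.castAdd m' i) p.2.1 p.1.2))|) ∂((((volume : Measure (Config (k + m') d (UnitAddTorus d))).prod (volume : Measure (EuclideanSpace ℝ d))).prod ((((volume : Measure (EuclideanSpace ℝ d)).toSphere).prod ((volume : Measure ℝ).restrict (Ioc 0 t)))))) := by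
      intro i
      have hK : Measurable fun q : ℝ × Config (k + (m' + 1)) d (UnitAddTorus d) => (fun (τ' : ℝ) (w : Config (k + (m' + 1)) d (UnitAddTorus d)) => ({w : Config (k + (m' + 1)) d (UnitAddTorus d) | (w ∘ Fin.castAdd (m' + 1) : Config k d (UnitAddTorus d)) ∈ Alexander.good (Torus.geometry d) ε ∧
      ENNReal.ofReal (t / ((n : ℝ) + 1)) < Alexander.freeExitTime (Torus.geometry d) ε (w ∘ Fin.castAdd (m' + 1) : Config k d (UnitAddTorus d)) ∧
      (collidePair (Torus.geometry d) (Fin.castAdd (m' + 1) i) (Fin.natAdd k (Fin.last m')) w ∘ Fin.castAdd (m' + 1) : Config k d (UnitAddTorus d)) ∈ Alexander.good (Torus.geometry d) ε ∧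
      ENNReal.ofReal (t / ((n : ℝ) + 1)) < Alexander.freeExitTime (Torus.geometry d) ε (flipVel (collidePair (Torus.geometry d) (Fin.castAdd (m' + 1) i) (Fin.natAdd k (Fin.last m')) w ∘ Fin.castAdd (m' + 1) : Config k d (UnitAddTorus d)))})ᶜ.indicator (1 : Config (k + (m' + 1)) d (UnitAddTorus d) → ℝ) w *
      |W (Alexander.regFlow (Torus.geometry d) ε (-τ') w)|) q.1 q.2 := by
        have hin : Measurable fun q : ℝ × Config (k + (m' + 1)) d (UnitAddTorus d) => ((-q.1, q.2) : ℝ × Config (k + (m' + 1)) d (UnitAddTorus d)) := measurable_fst.neg.prodMk measurable_snd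
        have h := (Alexander.measurable_regFlow_uncurry (d := d) (N := k + (m' + 1)) hε').comp hin
        exact ((measurable_const.indicator (measurableSet_gen hε' _ _ _).compl).comp measurable_snd).mul
          (continuous_abs.measurable.comp (hW.comp h))
      have h := (flux_windows_sum hε hε' (k := k) (m' := m') i (δ := t / ((n : ℝ) + 1)) (V := V) (ρ := ρ) (hδpos n) (n + 1) hρ hδV
        (fun (τ' : ℝ) (w : Config (k + (m' + 1)) d (UnitAddTorus d)) => ({w : Config (k + (m' + 1)) d (UnitAddTorus d) | (w ∘ Fin.castAdd (m' + 1) : Config k d (UnitAddTorus d)) ∈ Alexander.good (Torus.geometry d) ε ∧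
      ENNReal.ofReal (t / ((n : ℝ) + 1)) < Alexander.freeExitTime (Torus.geometry d) ε (w ∘ Fin.castAdd (m' + 1) : Config k d (UnitAddTorus d)) ∧
      (collidePair (Torus.geometry d) (Fin.castAdd (m' + 1) i) (Fin.natAdd k (Fin.last m')) w ∘ Fin.castAdd (m' + 1) : Config k d (UnitAddTorus d)) ∈ Alexander.good (Torus.geometry d) ε ∧
      ENNReal.ofReal (t / ((n : ℝ) + 1)) < Alexander.freeExitTime (Torus.geometry d) ε (flipVel (collidePair (Torus.geometry d) (Fin.castAdd (m' + 1) i) (Fin.natAdd k (Fin.last m')) w ∘ Fin.castAdd (m' + 1) : Config k d (UnitAddTorus d)))})ᶜ.indicator (1 : Config (k + (m' + 1)) d (UnitAddTorus d) → ℝ) w *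
      |W (Alexander.regFlow (Torus.geometry d) ε (-τ') w)|) hK (fun j _ => by
          have hint := integrable_eventSide_generr hε hε' (m' := m') i (j * (t / ((n : ℝ) + 1))) (t / ((n : ℝ) + 1)) V hW hWi _
            (measurableSet_gen hε' (Fin.castAdd (m' + 1) i) (Fin.natAdd k (Fin.last m')) (t / ((n : ℝ) + 1)))
          exact hint)).2
      rw [hNδ n] at h
      exact h
    -- the fast errors summed over the windows
    have hfast : ∀ i : Fin k, ∑ j ∈ Finset.range (n + 1), ∫ z, (Alexander.singleCollisionEvent (Torus.geometry d) ε (Fin.castAdd (m' + 1) i) (Fin.natAdd k (Fin.last m')) (t / ((n : ℝ) + 1))).indicator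
            (1 : Config (k + (m' + 1)) d (UnitAddTorus d) → ℝ) z *
          ({z : Config (k + (m' + 1)) d (UnitAddTorus d) | V < ‖(z (Fin.natAdd k (Fin.last m'))).2 - (z (Fin.castAdd (m' + 1) i)).2‖}.indicator (1 : Config (k + (m' + 1)) d (UnitAddTorus d) → ℝ) z *
            |W (Alexander.regFlow (Torus.geometry d) ε (-(j * (t / ((n : ℝ) + 1)))) z)|) ≤ (M : ℝ) * ∫ z₀ in Alexander.good (Torus.geometry d) ε,
        {z : Config (k + (m' + 1)) d (UnitAddTorus d) | V < 2 * Real.sqrt (2 * configEnergy z)}.indicator (1 : Config (k + (m' + 1)) d (UnitAddTorus d) → ℝ) z₀ * |W z₀| := fun i =>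
      sum_fast_le hε hε' (m' := m') i (hδpos n).le (n + 1) V hW hWi (fun z hz => hWM z (by rwa [hNδ n] at hz))
    -- combine
    have hD : ∀ i : Fin k, ∑ j ∈ Finset.range (n + 1), ∫ z, (Alexander.singleCollisionEvent (Torus.geometry d) ε (Fin.castAdd (m' + 1) i) (Fin.natAdd k (Fin.last m')) (t / ((n : ℝ) + 1))).indicator
            (1 : Config (k + (m' + 1)) d (UnitAddTorus d) → ℝ) z *
          (({z : Config (k + (m' + 1)) d (UnitAddTorus d) |
                V < ‖(z (Fin.natAdd k (Fin.last m'))).2 - (z (Fin.castAdd (m' + 1) i)).2‖}.indicator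
                (1 : Config (k + (m' + 1)) d (UnitAddTorus d) → ℝ) z +
              2 * ({w : Config (k + (m' + 1)) d (UnitAddTorus d) | (w ∘ Fin.castAdd (m' + 1) : Config k d (UnitAddTorus d)) ∈ Alexander.good (Torus.geometry d) ε ∧
                  ENNReal.ofReal (t / ((n : ℝ) + 1)) < Alexander.freeExitTime (Torus.geometry d) ε (w ∘ Fin.castAdd (m' + 1) : Config k d (UnitAddTorus d)) ∧
                  (collidePair (Torus.geometry d) (Fin.castAdd (m' + 1) i) (Fin.natAdd k (Fin.last m')) w ∘ Fin.castAdd (m' + 1) : Config k d (UnitAddTorus d)) ∈ Alexander.good (Torus.geometry d) ε ∧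
                  ENNReal.ofReal (t / ((n : ℝ) + 1)) < Alexander.freeExitTime (Torus.geometry d) ε (flipVel (collidePair (Torus.geometry d) (Fin.castAdd (m' + 1) i) (Fin.natAdd k (Fin.last m')) w ∘ Fin.castAdd (m' + 1) : Config k d (UnitAddTorus d)))})ᶜ.indicator (1 : Config (k + (m' + 1)) d (UnitAddTorus d) → ℝ)
                (collidePair (Torus.geometry d) (Fin.castAdd (m' + 1) i) (Fin.natAdd k (Fin.last m'))
                  (freeFlight (Torus.geometry d) (Alexander.collisionInstant (Torus.geometry d) ε z 1).toReal z))) *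
            |W (Alexander.regFlow (Torus.geometry d) ε (-(j * (t / ((n : ℝ) + 1)))) z)|) ≤ 3 * ((M : ℝ) * ∫ z₀ in Alexander.good (Torus.geometry d) ε,
        {z : Config (k + (m' + 1)) d (UnitAddTorus d) | V < 2 * Real.sqrt (2 * configEnergy z)}.indicator (1 : Config (k + (m' + 1)) d (UnitAddTorus d) → ℝ) z₀ * |W z₀|) + 2 * ∫ p, ε ^ (Fintype.card d - 1) * max ⟪p.1.2 - (p.1.1 (Fin.castAdd m' i)).2, (p.2.1 : EuclideanSpace ℝ d)⟫_ℝ 0 *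
          {v : EuclideanSpace ℝ d | ‖v - (p.1.1 (Fin.castAdd m' i)).2‖ ≤ V}.indicator (1 : EuclideanSpace ℝ d → ℝ) p.1.2 *
          (Alexander.singleCollisionEvent (Torus.geometry d) ε (Fin.castAdd 1 (Fin.castAdd m' i)) (Fin.natAdd (k + m') 0) (t / ((n : ℝ) + 1))).indicator
            (1 : Config (k + m' + 1) d (UnitAddTorus d) → ℝ)
            (freeFlight (Torus.geometry d) (-(p.2.2 - (t / ((n : ℝ) + 1) * ((⌈p.2.2 / (t / ((n : ℝ) + 1))⌉ : ℤ) - 1 : ℝ)))) (gainConfig (Torus.geometry d) ε p.1.1 (Fin.castAdd m' i) p.2.1 p.1.2)) *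
          (({w : Config (k + (m' + 1)) d (UnitAddTorus d) | (w ∘ Fin.castAdd (m' + 1) : Config k d (UnitAddTorus d)) ∈ Alexander.good (Torus.geometry d) ε ∧
            ENNReal.ofReal (t / ((n : ℝ) + 1)) < Alexander.freeExitTime (Torus.geometry d) ε (w ∘ Fin.castAdd (m' + 1) : Config k d (UnitAddTorus d)) ∧
            (collidePair (Torus.geometry d) (Fin.castAdd (m' + 1) i) (Fin.natAdd k (Fin.last m')) w ∘ Fin.castAdd (m' + 1) : Config k d (UnitAddTorus d)) ∈ Alexander.good (Torus.geometry d) ε ∧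
            ENNReal.ofReal (t / ((n : ℝ) + 1)) < Alexander.freeExitTime (Torus.geometry d) ε (flipVel (collidePair (Torus.geometry d) (Fin.castAdd (m' + 1) i) (Fin.natAdd k (Fin.last m')) w ∘ Fin.castAdd (m' + 1) : Config k d (UnitAddTorus d)))})ᶜ.indicator (1 : Config (k + (m' + 1)) d (UnitAddTorus d) → ℝ) (lossConfig (Torus.geometry d) ε p.1.1 (Fin.castAdd m' i) p.2.1 p.1.2) *
            |W (Alexander.regFlow (Torus.geometry d) ε (-p.2.2) (lossConfig (Torus.geometry d) ε p.1.1 (Fin.castAdd m' i) p.2.1 p.1.2))|) ∂((((volume : Measure (Config (k + m') d (UnitAddTorus d))).prod (volume : Measure (EuclideanSpace ℝ d))).prod ((((volume : Measure (EuclideanSpace ℝ d)).toSphere).prod ((volume : Measure ℝ).restrict (Ioc 0 t)))))) := by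
      intro i
      calc ∑ j ∈ Finset.range (n + 1), ∫ z, (Alexander.singleCollisionEvent (Torus.geometry d) ε (Fin.castAdd (m' + 1) i) (Fin.natAdd k (Fin.last m')) (t / ((n : ℝ) + 1))).indicator
            (1 : Config (k + (m' + 1)) d (UnitAddTorus d) → ℝ) z *
          (({z : Config (k + (m' + 1)) d (UnitAddTorus d) |
                V < ‖(z (Fin.natAdd k (Fin.last m'))).2 - (z (Fin.castAdd (m' + 1) i)).2‖}.indicator
                (1 : Config (k + (m' + 1)) d (UnitAddTorus d) → ℝ) z +
              2 * ({w : Config (k + (m' + 1)) d (UnitAddTorus d) | (w ∘ Fin.castAdd (m' + 1) : Config k d (UnitAddTorus d)) ∈ Alexander.good (Torus.geometry d) ε ∧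
                  ENNReal.ofReal (t / ((n : ℝ) + 1)) < Alexander.freeExitTime (Torus.geometry d) ε (w ∘ Fin.castAdd (m' + 1) : Config k d (UnitAddTorus d)) ∧
                  (collidePair (Torus.geometry d) (Fin.castAdd (m' + 1) i) (Fin.natAdd k (Fin.last m')) w ∘ Fin.castAdd (m' + 1) : Config k d (UnitAddTorus d)) ∈ Alexander.good (Torus.geometry d) ε ∧
                  ENNReal.ofReal (t / ((n : ℝ) + 1)) < Alexander.freeExitTime (Torus.geometry d) ε (flipVel (collidePair (Torus.geometry d) (Fin.castAdd (m' + 1) i) (Fin.natAdd k (Fin.last m')) w ∘ Fin.castAdd (m' + 1) : Config k d (UnitAddTorus d)))})ᶜ.indicator (1 : Config (k + (m' + 1)) d (UnitAddTorus d) → ℝ)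
                (collidePair (Torus.geometry d) (Fin.castAdd (m' + 1) i) (Fin.natAdd k (Fin.last m'))
                  (freeFlight (Torus.geometry d) (Alexander.collisionInstant (Torus.geometry d) ε z 1).toReal z))) *
            |W (Alexander.regFlow (Torus.geometry d) ε (-(j * (t / ((n : ℝ) + 1)))) z)|)
          ≤ ∑ j ∈ Finset.range (n + 1), (3 * (∫ z, (Alexander.singleCollisionEvent (Torus.geometry d) ε (Fin.castAdd (m' + 1) i) (Fin.natAdd k (Fin.last m')) (t / ((n : ℝ) + 1))).indicator
            (1 : Config (k + (m' + 1)) d (UnitAddTorus d) → ℝ) z *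
          ({z : Config (k + (m' + 1)) d (UnitAddTorus d) | V < ‖(z (Fin.natAdd k (Fin.last m'))).2 - (z (Fin.castAdd (m' + 1) i)).2‖}.indicator (1 : Config (k + (m' + 1)) d (UnitAddTorus d) → ℝ) z *
            |W (Alexander.regFlow (Torus.geometry d) ε (-(j * (t / ((n : ℝ) + 1)))) z)|)) + 2 * ∫ p, ε ^ (Fintype.card d - 1) * max ⟪p.1.2 - (p.1.1 (Fin.castAdd m' i)).2, (p.2.1 : EuclideanSpace ℝ d)⟫_ℝ 0 *
          {v : EuclideanSpace ℝ d | ‖v - (p.1.1 (Fin.castAdd m' i)).2‖ ≤ V}.indicator (1 : EuclideanSpace ℝ d → ℝ) p.1.2 *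
          (Alexander.singleCollisionEvent (Torus.geometry d) ε (Fin.castAdd 1 (Fin.castAdd m' i)) (Fin.natAdd (k + m') 0) (t / ((n : ℝ) + 1))).indicator
            (1 : Config (k + m' + 1) d (UnitAddTorus d) → ℝ)
            (freeFlight (Torus.geometry d) (-p.2.2) (gainConfig (Torus.geometry d) ε p.1.1 (Fin.castAdd m' i) p.2.1 p.1.2)) *
          (({w : Config (k + (m' + 1)) d (UnitAddTorus d) | (w ∘ Fin.castAdd (m' + 1) : Config k d (UnitAddTorus d)) ∈ Alexander.good (Torus.geometry d) ε ∧
            ENNReal.ofReal (t / ((n : ℝ) + 1)) < Alexander.freeExitTime (Torus.geometry d) ε (w ∘ Fin.castAdd (m' + 1) : Config k d (UnitAddTorus d)) ∧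
            (collidePair (Torus.geometry d) (Fin.castAdd (m' + 1) i) (Fin.natAdd k (Fin.last m')) w ∘ Fin.castAdd (m' + 1) : Config k d (UnitAddTorus d)) ∈ Alexander.good (Torus.geometry d) ε ∧
            ENNReal.ofReal (t / ((n : ℝ) + 1)) < Alexander.freeExitTime (Torus.geometry d) ε (flipVel (collidePair (Torus.geometry d) (Fin.castAdd (m' + 1) i) (Fin.natAdd k (Fin.last m')) w ∘ Fin.castAdd (m' + 1) : Config k d (UnitAddTorus d)))})ᶜ.indicator (1 : Config (k + (m' + 1)) d (UnitAddTorus d) → ℝ) (lossConfig (Torus.geometry d) ε p.1.1 (Fin.castAdd m' i) p.2.1 p.1.2) *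
            |W (Alexander.regFlow (Torus.geometry d) ε (-(j * (t / ((n : ℝ) + 1)) + p.2.2)) (lossConfig (Torus.geometry d) ε p.1.1 (Fin.castAdd m' i) p.2.1 p.1.2))|) ∂((((volume : Measure (Config (k + m') d (UnitAddTorus d))).prod (volume : Measure (EuclideanSpace ℝ d))).prod ((((volume : Measure (EuclideanSpace ℝ d)).toSphere).prod ((volume : Measure ℝ).restrict (Ioc 0 (t / ((n : ℝ) + 1))))))))) := Finset.sum_le_sum fun j _ => herr i j
        _ = 3 * (∑ j ∈ Finset.range (n + 1), ∫ z, (Alexander.singleCollisionEvent (Torus.geometry d) ε (Fin.castAdd (m' + 1) i) (Fin.natAdd k (Fin.last m')) (t / ((n : ℝ) + 1))).indicator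
            (1 : Config (k + (m' + 1)) d (UnitAddTorus d) → ℝ) z *
          ({z : Config (k + (m' + 1)) d (UnitAddTorus d) | V < ‖(z (Fin.natAdd k (Fin.last m'))).2 - (z (Fin.castAdd (m' + 1) i)).2‖}.indicator (1 : Config (k + (m' + 1)) d (UnitAddTorus d) → ℝ) z *
            |W (Alexander.regFlow (Torus.geometry d) ε (-(j * (t / ((n : ℝ) + 1)))) z)|)) + 2 * ∑ j ∈ Finset.range (n + 1), ∫ p, ε ^ (Fintype.card d - 1) * max ⟪p.1.2 - (p.1.1 (Fin.castAdd m' i)).2, (p.2.1 : EuclideanSpace ℝ d)⟫_ℝ 0 *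
          {v : EuclideanSpace ℝ d | ‖v - (p.1.1 (Fin.castAdd m' i)).2‖ ≤ V}.indicator (1 : EuclideanSpace ℝ d → ℝ) p.1.2 *
          (Alexander.singleCollisionEvent (Torus.geometry d) ε (Fin.castAdd 1 (Fin.castAdd m' i)) (Fin.natAdd (k + m') 0) (t / ((n : ℝ) + 1))).indicator
            (1 : Config (k + m' + 1) d (UnitAddTorus d) → ℝ)
            (freeFlight (Torus.geometry d) (-p.2.2) (gainConfig (Torus.geometry d) ε p.1.1 (Fin.castAdd m' i) p.2.1 p.1.2)) *
          (({w : Config (k + (m' + 1)) d (UnitAddTorus d) | (w ∘ Fin.castAdd (m' + 1) : Config k d (UnitAddTorus d)) ∈ Alexander.good (Torus.geometry d) ε ∧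
            ENNReal.ofReal (t / ((n : ℝ) + 1)) < Alexander.freeExitTime (Torus.geometry d) ε (w ∘ Fin.castAdd (m' + 1) : Config k d (UnitAddTorus d)) ∧
            (collidePair (Torus.geometry d) (Fin.castAdd (m' + 1) i) (Fin.natAdd k (Fin.last m')) w ∘ Fin.castAdd (m' + 1) : Config k d (UnitAddTorus d)) ∈ Alexander.good (Torus.geometry d) ε ∧
            ENNReal.ofReal (t / ((n : ℝ) + 1)) < Alexander.freeExitTime (Torus.geometry d) ε (flipVel (collidePair (Torus.geometry d) (Fin.castAdd (m' + 1) i) (Fin.natAdd k (Fin.last m')) w ∘ Fin.castAdd (m' + 1) : Config k d (UnitAddTorus d)))})ᶜ.indicator (1 : Config (k + (m' + 1)) d (UnitAddTorus d) → ℝ) (lossConfig (Torus.geometry d) ε p.1.1 (Fin.castAdd m' i) p.2.1 p.1.2) *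
            |W (Alexander.regFlow (Torus.geometry d) ε (-(j * (t / ((n : ℝ) + 1)) + p.2.2)) (lossConfig (Torus.geometry d) ε p.1.1 (Fin.castAdd m' i) p.2.1 p.1.2))|) ∂((((volume : Measure (Config (k + m') d (UnitAddTorus d))).prod (volume : Measure (EuclideanSpace ℝ d))).prod ((((volume : Measure (EuclideanSpace ℝ d)).toSphere).prod ((volume : Measure ℝ).restrict (Ioc 0 (t / ((n : ℝ) + 1)))))))) := by
            rw [Finset.sum_add_distrib, ← Finset.mul_sum, ← Finset.mul_sum]
        _ ≤ 3 * ((M : ℝ) * ∫ z₀ in Alexander.good (Torus.geometry d) ε,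
        {z : Config (k + (m' + 1)) d (UnitAddTorus d) | V < 2 * Real.sqrt (2 * configEnergy z)}.indicator (1 : Config (k + (m' + 1)) d (UnitAddTorus d) → ℝ) z₀ * |W z₀|) + 2 * ∫ p, ε ^ (Fintype.card d - 1) * max ⟪p.1.2 - (p.1.1 (Fin.castAdd m' i)).2, (p.2.1 : EuclideanSpace ℝ d)⟫_ℝ 0 *
          {v : EuclideanSpace ℝ d | ‖v - (p.1.1 (Fin.castAdd m' i)).2‖ ≤ V}.indicator (1 : EuclideanSpace ℝ d → ℝ) p.1.2 *
          (Alexander.singleCollisionEvent (Torus.geometry d) ε (Fin.castAdd 1 (Fin.castAdd m' i)) (Fin.natAdd (k + m') 0) (t / ((n : ℝ) + 1))).indicator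
            (1 : Config (k + m' + 1) d (UnitAddTorus d) → ℝ)
            (freeFlight (Torus.geometry d) (-(p.2.2 - (t / ((n : ℝ) + 1) * ((⌈p.2.2 / (t / ((n : ℝ) + 1))⌉ : ℤ) - 1 : ℝ)))) (gainConfig (Torus.geometry d) ε p.1.1 (Fin.castAdd m' i) p.2.1 p.1.2)) *
          (({w : Config (k + (m' + 1)) d (UnitAddTorus d) | (w ∘ Fin.castAdd (m' + 1) : Config k d (UnitAddTorus d)) ∈ Alexander.good (Torus.geometry d) ε ∧
            ENNReal.ofReal (t / ((n : ℝ) + 1)) < Alexander.freeExitTime (Torus.geometry d) ε (w ∘ Fin.castAdd (m' + 1) : Config k d (UnitAddTorus d)) ∧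
            (collidePair (Torus.geometry d) (Fin.castAdd (m' + 1) i) (Fin.natAdd k (Fin.last m')) w ∘ Fin.castAdd (m' + 1) : Config k d (UnitAddTorus d)) ∈ Alexander.good (Torus.geometry d) ε ∧
            ENNReal.ofReal (t / ((n : ℝ) + 1)) < Alexander.freeExitTime (Torus.geometry d) ε (flipVel (collidePair (Torus.geometry d) (Fin.castAdd (m' + 1) i) (Fin.natAdd k (Fin.last m')) w ∘ Fin.castAdd (m' + 1) : Config k d (UnitAddTorus d)))})ᶜ.indicator (1 : Config (k + (m' + 1)) d (UnitAddTorus d) → ℝ) (lossConfig (Torus.geometry d) ε p.1.1 (Fin.castAdd m' i) p.2.1 p.1.2) *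
            |W (Alexander.regFlow (Torus.geometry d) ε (-p.2.2) (lossConfig (Torus.geometry d) ε p.1.1 (Fin.castAdd m' i) p.2.1 p.1.2))|) ∂((((volume : Measure (Config (k + m') d (UnitAddTorus d))).prod (volume : Measure (EuclideanSpace ℝ d))).prod ((((volume : Measure (EuclideanSpace ℝ d)).toSphere).prod ((volume : Measure ℝ).restrict (Ioc 0 t)))))) := by
            rw [hsg i]
            linarith [hfast i]
    have hDsum : (m' + 1 : ℝ) * ∑ i : Fin k, ∑ j ∈ Finset.range (n + 1), ∫ z, (Alexander.singleCollisionEvent (Torus.geometry d) ε (Fin.castAdd (m' + 1) i) (Fin.natAdd k (Fin.last m')) (t / ((n : ℝ) + 1))).indicator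
            (1 : Config (k + (m' + 1)) d (UnitAddTorus d) → ℝ) z *
          (({z : Config (k + (m' + 1)) d (UnitAddTorus d) |
                V < ‖(z (Fin.natAdd k (Fin.last m'))).2 - (z (Fin.castAdd (m' + 1) i)).2‖}.indicator
                (1 : Config (k + (m' + 1)) d (UnitAddTorus d) → ℝ) z +
              2 * ({w : Config (k + (m' + 1)) d (UnitAddTorus d) | (w ∘ Fin.castAdd (m' + 1) : Config k d (UnitAddTorus d)) ∈ Alexander.good (Torus.geometry d) ε ∧
                  ENNReal.ofReal (t / ((n : ℝ) + 1)) < Alexander.freeExitTime (Torus.geometry d) ε (w ∘ Fin.castAdd (m' + 1) : Config k d (UnitAddTorus d)) ∧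
                  (collidePair (Torus.geometry d) (Fin.castAdd (m' + 1) i) (Fin.natAdd k (Fin.last m')) w ∘ Fin.castAdd (m' + 1) : Config k d (UnitAddTorus d)) ∈ Alexander.good (Torus.geometry d) ε ∧
                  ENNReal.ofReal (t / ((n : ℝ) + 1)) < Alexander.freeExitTime (Torus.geometry d) ε (flipVel (collidePair (Torus.geometry d) (Fin.castAdd (m' + 1) i) (Fin.natAdd k (Fin.last m')) w ∘ Fin.castAdd (m' + 1) : Config k d (UnitAddTorus d)))})ᶜ.indicator (1 : Config (k + (m' + 1)) d (UnitAddTorus d) → ℝ)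
                (collidePair (Torus.geometry d) (Fin.castAdd (m' + 1) i) (Fin.natAdd k (Fin.last m'))
                  (freeFlight (Torus.geometry d) (Alexander.collisionInstant (Torus.geometry d) ε z 1).toReal z))) *
            |W (Alexander.regFlow (Torus.geometry d) ε (-(j * (t / ((n : ℝ) + 1)))) z)|) ≤
        (m' + 1 : ℝ) * ∑ i : Fin k, (3 * ((M : ℝ) * ∫ z₀ in Alexander.good (Torus.geometry d) ε,
        {z : Config (k + (m' + 1)) d (UnitAddTorus d) | V < 2 * Real.sqrt (2 * configEnergy z)}.indicator (1 : Config (k + (m' + 1)) d (UnitAddTorus d) → ℝ) z₀ * |W z₀|) + 2 * ∫ p, ε ^ (Fintype.card d - 1) * max ⟪p.1.2 - (p.1.1 (Fin.castAdd m' i)).2, (p.2.1 : EuclideanSpace ℝ d)⟫_ℝ 0 *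
          {v : EuclideanSpace ℝ d | ‖v - (p.1.1 (Fin.castAdd m' i)).2‖ ≤ V}.indicator (1 : EuclideanSpace ℝ d → ℝ) p.1.2 *
          (Alexander.singleCollisionEvent (Torus.geometry d) ε (Fin.castAdd 1 (Fin.castAdd m' i)) (Fin.natAdd (k + m') 0) (t / ((n : ℝ) + 1))).indicator
            (1 : Config (k + m' + 1) d (UnitAddTorus d) → ℝ)
            (freeFlight (Torus.geometry d) (-(p.2.2 - (t / ((n : ℝ) + 1) * ((⌈p.2.2 / (t / ((n : ℝ) + 1))⌉ : ℤ) - 1 : ℝ)))) (gainConfig (Torus.geometry d) ε p.1.1 (Fin.castAdd m' i) p.2.1 p.1.2)) *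
          (({w : Config (k + (m' + 1)) d (UnitAddTorus d) | (w ∘ Fin.castAdd (m' + 1) : Config k d (UnitAddTorus d)) ∈ Alexander.good (Torus.geometry d) ε ∧
            ENNReal.ofReal (t / ((n : ℝ) + 1)) < Alexander.freeExitTime (Torus.geometry d) ε (w ∘ Fin.castAdd (m' + 1) : Config k d (UnitAddTorus d)) ∧
            (collidePair (Torus.geometry d) (Fin.castAdd (m' + 1) i) (Fin.natAdd k (Fin.last m')) w ∘ Fin.castAdd (m' + 1) : Config k d (UnitAddTorus d)) ∈ Alexander.good (Torus.geometry d) ε ∧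
            ENNReal.ofReal (t / ((n : ℝ) + 1)) < Alexander.freeExitTime (Torus.geometry d) ε (flipVel (collidePair (Torus.geometry d) (Fin.castAdd (m' + 1) i) (Fin.natAdd k (Fin.last m')) w ∘ Fin.castAdd (m' + 1) : Config k d (UnitAddTorus d)))})ᶜ.indicator (1 : Config (k + (m' + 1)) d (UnitAddTorus d) → ℝ) (lossConfig (Torus.geometry d) ε p.1.1 (Fin.castAdd m' i) p.2.1 p.1.2) *
            |W (Alexander.regFlow (Torus.geometry d) ε (-p.2.2) (lossConfig (Torus.geometry d) ε p.1.1 (Fin.castAdd m' i) p.2.1 p.1.2))|) ∂((((volume : Measure (Config (k + m') d (UnitAddTorus d))).prod (volume : Measure (EuclideanSpace ℝ d))).prod ((((volume : Measure (EuclideanSpace ℝ d)).toSphere).prod ((volume : Measure ℝ).restrict (Ioc 0 t))))))) :=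
      mul_le_mul_of_nonneg_left (Finset.sum_le_sum fun i _ => hD i) (by positivity)
    calc _ ≤ |((∫ z₀ in Alexander.good (Torus.geometry d) ε,
          (Alexander.regFlow (Torus.geometry d) ε (t) '' B).indicator (1 : Config k d (UnitAddTorus d) → ℝ) (Alexander.regFlow (Torus.geometry d) ε (t) z₀ ∘ Fin.castAdd (m' + 1)) * W z₀) -
          ∫ z₀ in Alexander.good (Torus.geometry d) ε, (Alexander.regFlow (Torus.geometry d) ε (0) '' B).indicator (1 : Config k d (UnitAddTorus d) → ℝ) (z₀ ∘ Fin.castAdd (m' + 1)) * W z₀) -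
        (m' + 1 : ℝ) * ∑ i : Fin k, ∫ p, ε ^ (Fintype.card d - 1) * max ⟪p.1.2 - (p.1.1 (Fin.castAdd m' i)).2, (p.2.1 : EuclideanSpace ℝ d)⟫_ℝ 0 *
          {v : EuclideanSpace ℝ d | ‖v - (p.1.1 (Fin.castAdd m' i)).2‖ ≤ V}.indicator (1 : EuclideanSpace ℝ d → ℝ) p.1.2 *
          (Alexander.singleCollisionEvent (Torus.geometry d) ε (Fin.castAdd 1 (Fin.castAdd m' i)) (Fin.natAdd (k + m') 0) (t / ((n : ℝ) + 1))).indicator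
            (1 : Config (k + m' + 1) d (UnitAddTorus d) → ℝ)
            (freeFlight (Torus.geometry d) (-(p.2.2 - (t / ((n : ℝ) + 1) * ((⌈p.2.2 / (t / ((n : ℝ) + 1))⌉ : ℤ) - 1 : ℝ)))) (gainConfig (Torus.geometry d) ε p.1.1 (Fin.castAdd m' i) p.2.1 p.1.2)) *
          ({w : Config (k + (m' + 1)) d (UnitAddTorus d) | (w ∘ Fin.castAdd (m' + 1) : Config k d (UnitAddTorus d)) ∈ Alexander.good (Torus.geometry d) ε ∧
            ENNReal.ofReal (t / ((n : ℝ) + 1)) < Alexander.freeExitTime (Torus.geometry d) ε (w ∘ Fin.castAdd (m' + 1) : Config k d (UnitAddTorus d)) ∧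
            (collidePair (Torus.geometry d) (Fin.castAdd (m' + 1) i) (Fin.natAdd k (Fin.last m')) w ∘ Fin.castAdd (m' + 1) : Config k d (UnitAddTorus d)) ∈ Alexander.good (Torus.geometry d) ε ∧
            ENNReal.ofReal (t / ((n : ℝ) + 1)) < Alexander.freeExitTime (Torus.geometry d) ε (flipVel (collidePair (Torus.geometry d) (Fin.castAdd (m' + 1) i) (Fin.natAdd k (Fin.last m')) w ∘ Fin.castAdd (m' + 1) : Config k d (UnitAddTorus d)))}).indicator (fun w =>
            ((Alexander.regFlow (Torus.geometry d) ε (p.2.2) '' B).indicator (1 : Config k d (UnitAddTorus d) → ℝ) (w ∘ Fin.castAdd (m' + 1)) -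
              (Alexander.regFlow (Torus.geometry d) ε (p.2.2) '' B).indicator (1 : Config k d (UnitAddTorus d) → ℝ) (collidePair (Torus.geometry d) (Fin.castAdd (m' + 1) i) (Fin.natAdd k (Fin.last m')) w ∘ Fin.castAdd (m' + 1))) *
            W (Alexander.regFlow (Torus.geometry d) ε (-p.2.2) w)) (lossConfig (Torus.geometry d) ε p.1.1 (Fin.castAdd m' i) p.2.1 p.1.2) ∂((((volume : Measure (Config (k + m') d (UnitAddTorus d))).prod (volume : Measure (EuclideanSpace ℝ d))).prod ((((volume : Measure (EuclideanSpace ℝ d)).toSphere).prod ((volume : Measure ℝ).restrict (Ioc 0 t))))))| +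
        |(m' + 1 : ℝ) * ∑ i : Fin k, ∫ p, ε ^ (Fintype.card d - 1) * max ⟪p.1.2 - (p.1.1 (Fin.castAdd m' i)).2, (p.2.1 : EuclideanSpace ℝ d)⟫_ℝ 0 *
          {v : EuclideanSpace ℝ d | ‖v - (p.1.1 (Fin.castAdd m' i)).2‖ ≤ V}.indicator (1 : EuclideanSpace ℝ d → ℝ) p.1.2 *
          (Alexander.singleCollisionEvent (Torus.geometry d) ε (Fin.castAdd 1 (Fin.castAdd m' i)) (Fin.natAdd (k + m') 0) (t / ((n : ℝ) + 1))).indicator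
            (1 : Config (k + m' + 1) d (UnitAddTorus d) → ℝ)
            (freeFlight (Torus.geometry d) (-(p.2.2 - (t / ((n : ℝ) + 1) * ((⌈p.2.2 / (t / ((n : ℝ) + 1))⌉ : ℤ) - 1 : ℝ)))) (gainConfig (Torus.geometry d) ε p.1.1 (Fin.castAdd m' i) p.2.1 p.1.2)) *
          ({w : Config (k + (m' + 1)) d (UnitAddTorus d) | (w ∘ Fin.castAdd (m' + 1) : Config k d (UnitAddTorus d)) ∈ Alexander.good (Torus.geometry d) ε ∧
            ENNReal.ofReal (t / ((n : ℝ) + 1)) < Alexander.freeExitTime (Torus.geometry d) ε (w ∘ Fin.castAdd (m' + 1) : Config k d (UnitAddTorus d)) ∧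
            (collidePair (Torus.geometry d) (Fin.castAdd (m' + 1) i) (Fin.natAdd k (Fin.last m')) w ∘ Fin.castAdd (m' + 1) : Config k d (UnitAddTorus d)) ∈ Alexander.good (Torus.geometry d) ε ∧
            ENNReal.ofReal (t / ((n : ℝ) + 1)) < Alexander.freeExitTime (Torus.geometry d) ε (flipVel (collidePair (Torus.geometry d) (Fin.castAdd (m' + 1) i) (Fin.natAdd k (Fin.last m')) w ∘ Fin.castAdd (m' + 1) : Config k d (UnitAddTorus d)))}).indicator (fun w =>
            ((Alexander.regFlow (Torus.geometry d) ε (p.2.2) '' B).indicator (1 : Config k d (UnitAddTorus d) → ℝ) (w ∘ Fin.castAdd (m' + 1)) -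
              (Alexander.regFlow (Torus.geometry d) ε (p.2.2) '' B).indicator (1 : Config k d (UnitAddTorus d) → ℝ) (collidePair (Torus.geometry d) (Fin.castAdd (m' + 1) i) (Fin.natAdd k (Fin.last m')) w ∘ Fin.castAdd (m' + 1))) *
            W (Alexander.regFlow (Torus.geometry d) ε (-p.2.2) w)) (lossConfig (Torus.geometry d) ε p.1.1 (Fin.castAdd m' i) p.2.1 p.1.2) ∂((((volume : Measure (Config (k + m') d (UnitAddTorus d))).prod (volume : Measure (EuclideanSpace ℝ d))).prod ((((volume : Measure (EuclideanSpace ℝ d)).toSphere).prod ((volume : Measure ℝ).restrict (Ioc 0 t)))))) -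
          (m' + 1 : ℝ) * ∑ i : Fin k, ∫ p, ε ^ (Fintype.card d - 1) * max ⟪p.1.2 - (p.1.1 (Fin.castAdd m' i)).2, (p.2.1 : EuclideanSpace ℝ d)⟫_ℝ 0 *
          {v : EuclideanSpace ℝ d | ‖v - (p.1.1 (Fin.castAdd m' i)).2‖ ≤ V}.indicator (1 : EuclideanSpace ℝ d → ℝ) p.1.2 *
          (Alexander.good (Torus.geometry d) ε).indicator (fun w =>
            ((Alexander.regFlow (Torus.geometry d) ε (p.2.2) '' B).indicator (1 : Config k d (UnitAddTorus d) → ℝ) (w ∘ Fin.castAdd (m' + 1)) -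
              (Alexander.regFlow (Torus.geometry d) ε (p.2.2) '' B).indicator (1 : Config k d (UnitAddTorus d) → ℝ) (collidePair (Torus.geometry d) (Fin.castAdd (m' + 1) i) (Fin.natAdd k (Fin.last m')) w ∘ Fin.castAdd (m' + 1))) *
            W (Alexander.regFlow (Torus.geometry d) ε (-p.2.2) w)) (lossConfig (Torus.geometry d) ε p.1.1 (Fin.castAdd m' i) p.2.1 p.1.2) ∂((((volume : Measure (Config (k + m') d (UnitAddTorus d))).prod (volume : Measure (EuclideanSpace ℝ d))).prod ((((volume : Measure (EuclideanSpace ℝ d)).toSphere).prod ((volume : Measure ℝ).restrict (Ioc 0 t))))))| := abs_sub_le _ _ _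
      _ ≤ _ := by linarith [hwin, hDsum]
  -- the limit of the right-hand side
  have hRlim : Tendsto (fun n : ℕ => (2 * (∫ z₀ in Alexander.good (Torus.geometry d) ε,
        (∑ j ∈ Finset.range (n + 1), {z₀ : Config (k + (m' + 1)) d (UnitAddTorus d) |
          Alexander.collisionCount (Torus.geometry d) ε z₀ (j * (t / ((n : ℝ) + 1))) + 2 ≤ Alexander.collisionCount (Torus.geometry d) ε z₀ (j * (t / ((n : ℝ) + 1)) + t / ((n : ℝ) + 1))}.indicator
            (1 : Config (k + (m' + 1)) d (UnitAddTorus d) → ℝ) z₀) * |W z₀|) +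
        (m' + 1 : ℝ) * ∑ i : Fin k, (3 * ((M : ℝ) * ∫ z₀ in Alexander.good (Torus.geometry d) ε,
        {z : Config (k + (m' + 1)) d (UnitAddTorus d) | V < 2 * Real.sqrt (2 * configEnergy z)}.indicator (1 : Config (k + (m' + 1)) d (UnitAddTorus d) → ℝ) z₀ * |W z₀|) + 2 * ∫ p, ε ^ (Fintype.card d - 1) * max ⟪p.1.2 - (p.1.1 (Fin.castAdd m' i)).2, (p.2.1 : EuclideanSpace ℝ d)⟫_ℝ 0 *
          {v : EuclideanSpace ℝ d | ‖v - (p.1.1 (Fin.castAdd m' i)).2‖ ≤ V}.indicator (1 : EuclideanSpace ℝ d → ℝ) p.1.2 *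
          (Alexander.singleCollisionEvent (Torus.geometry d) ε (Fin.castAdd 1 (Fin.castAdd m' i)) (Fin.natAdd (k + m') 0) (t / ((n : ℝ) + 1))).indicator
            (1 : Config (k + m' + 1) d (UnitAddTorus d) → ℝ)
            (freeFlight (Torus.geometry d) (-(p.2.2 - (t / ((n : ℝ) + 1) * ((⌈p.2.2 / (t / ((n : ℝ) + 1))⌉ : ℤ) - 1 : ℝ)))) (gainConfig (Torus.geometry d) ε p.1.1 (Fin.castAdd m' i) p.2.1 p.1.2)) *
          (({w : Config (k + (m' + 1)) d (UnitAddTorus d) | (w ∘ Fin.castAdd (m' + 1) : Config k d (UnitAddTorus d)) ∈ Alexander.good (Torus.geometry d) ε ∧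
            ENNReal.ofReal (t / ((n : ℝ) + 1)) < Alexander.freeExitTime (Torus.geometry d) ε (w ∘ Fin.castAdd (m' + 1) : Config k d (UnitAddTorus d)) ∧
            (collidePair (Torus.geometry d) (Fin.castAdd (m' + 1) i) (Fin.natAdd k (Fin.last m')) w ∘ Fin.castAdd (m' + 1) : Config k d (UnitAddTorus d)) ∈ Alexander.good (Torus.geometry d) ε ∧
            ENNReal.ofReal (t / ((n : ℝ) + 1)) < Alexander.freeExitTime (Torus.geometry d) ε (flipVel (collidePair (Torus.geometry d) (Fin.castAdd (m' + 1) i) (Fin.natAdd k (Fin.last m')) w ∘ Fin.castAdd (m' + 1) : Config k d (UnitAddTorus d)))})ᶜ.indicator (1 : Config (k + (m' + 1)) d (UnitAddTorus d) → ℝ) (lossConfig (Torus.geometry d) ε p.1.1 (Fin.castAdd m' i) p.2.1 p.1.2) *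
            |W (Alexander.regFlow (Torus.geometry d) ε (-p.2.2) (lossConfig (Torus.geometry d) ε p.1.1 (Fin.castAdd m' i) p.2.1 p.1.2))|) ∂((((volume : Measure (Config (k + m') d (UnitAddTorus d))).prod (volume : Measure (EuclideanSpace ℝ d))).prod ((((volume : Measure (EuclideanSpace ℝ d)).toSphere).prod ((volume : Measure ℝ).restrict (Ioc 0 t)))))))) +
      |(m' + 1 : ℝ) * ∑ i : Fin k, ∫ p, ε ^ (Fintype.card d - 1) * max ⟪p.1.2 - (p.1.1 (Fin.castAdd m' i)).2, (p.2.1 : EuclideanSpace ℝ d)⟫_ℝ 0 *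
          {v : EuclideanSpace ℝ d | ‖v - (p.1.1 (Fin.castAdd m' i)).2‖ ≤ V}.indicator (1 : EuclideanSpace ℝ d → ℝ) p.1.2 *
          (Alexander.singleCollisionEvent (Torus.geometry d) ε (Fin.castAdd 1 (Fin.castAdd m' i)) (Fin.natAdd (k + m') 0) (t / ((n : ℝ) + 1))).indicator
            (1 : Config (k + m' + 1) d (UnitAddTorus d) → ℝ)
            (freeFlight (Torus.geometry d) (-(p.2.2 - (t / ((n : ℝ) + 1) * ((⌈p.2.2 / (t / ((n : ℝ) + 1))⌉ : ℤ) - 1 : ℝ)))) (gainConfig (Torus.geometry d) ε p.1.1 (Fin.castAdd m' i) p.2.1 p.1.2)) *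
          ({w : Config (k + (m' + 1)) d (UnitAddTorus d) | (w ∘ Fin.castAdd (m' + 1) : Config k d (UnitAddTorus d)) ∈ Alexander.good (Torus.geometry d) ε ∧
            ENNReal.ofReal (t / ((n : ℝ) + 1)) < Alexander.freeExitTime (Torus.geometry d) ε (w ∘ Fin.castAdd (m' + 1) : Config k d (UnitAddTorus d)) ∧
            (collidePair (Torus.geometry d) (Fin.castAdd (m' + 1) i) (Fin.natAdd k (Fin.last m')) w ∘ Fin.castAdd (m' + 1) : Config k d (UnitAddTorus d)) ∈ Alexander.good (Torus.geometry d) ε ∧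
            ENNReal.ofReal (t / ((n : ℝ) + 1)) < Alexander.freeExitTime (Torus.geometry d) ε (flipVel (collidePair (Torus.geometry d) (Fin.castAdd (m' + 1) i) (Fin.natAdd k (Fin.last m')) w ∘ Fin.castAdd (m' + 1) : Config k d (UnitAddTorus d)))}).indicator (fun w =>
            ((Alexander.regFlow (Torus.geometry d) ε (p.2.2) '' B).indicator (1 : Config k d (UnitAddTorus d) → ℝ) (w ∘ Fin.castAdd (m' + 1)) -
              (Alexander.regFlow (Torus.geometry d) ε (p.2.2) '' B).indicator (1 : Config k d (UnitAddTorus d) → ℝ) (collidePair (Torus.geometry d) (Fin.castAdd (m' + 1) i) (Fin.natAdd k (Fin.last m')) w ∘ Fin.castAdd (m' + 1))) *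
            W (Alexander.regFlow (Torus.geometry d) ε (-p.2.2) w)) (lossConfig (Torus.geometry d) ε p.1.1 (Fin.castAdd m' i) p.2.1 p.1.2) ∂((((volume : Measure (Config (k + m') d (UnitAddTorus d))).prod (volume : Measure (EuclideanSpace ℝ d))).prod ((((volume : Measure (EuclideanSpace ℝ d)).toSphere).prod ((volume : Measure ℝ).restrict (Ioc 0 t)))))) -
        (m' + 1 : ℝ) * ∑ i : Fin k, ∫ p, ε ^ (Fintype.card d - 1) * max ⟪p.1.2 - (p.1.1 (Fin.castAdd m' i)).2, (p.2.1 : EuclideanSpace ℝ d)⟫_ℝ 0 *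
          {v : EuclideanSpace ℝ d | ‖v - (p.1.1 (Fin.castAdd m' i)).2‖ ≤ V}.indicator (1 : EuclideanSpace ℝ d → ℝ) p.1.2 *
          (Alexander.good (Torus.geometry d) ε).indicator (fun w =>
            ((Alexander.regFlow (Torus.geometry d) ε (p.2.2) '' B).indicator (1 : Config k d (UnitAddTorus d) → ℝ) (w ∘ Fin.castAdd (m' + 1)) -
              (Alexander.regFlow (Torus.geometry d) ε (p.2.2) '' B).indicator (1 : Config k d (UnitAddTorus d) → ℝ) (collidePair (Torus.geometry d) (Fin.castAdd (m' + 1) i) (Fin.natAdd k (Fin.last m')) w ∘ Fin.castAdd (m' + 1))) *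
            W (Alexander.regFlow (Torus.geometry d) ε (-p.2.2) w)) (lossConfig (Torus.geometry d) ε p.1.1 (Fin.castAdd m' i) p.2.1 p.1.2) ∂((((volume : Measure (Config (k + m') d (UnitAddTorus d))).prod (volume : Measure (EuclideanSpace ℝ d))).prod ((((volume : Measure (EuclideanSpace ℝ d)).toSphere).prod ((volume : Measure ℝ).restrict (Ioc 0 t))))))|) atTop
      (𝓝 ((2 * 0 + (m' + 1 : ℝ) * ∑ i : Fin k, (3 * ((M : ℝ) * ∫ z₀ in Alexander.good (Torus.geometry d) ε,
        {z : Config (k + (m' + 1)) d (UnitAddTorus d) | V < 2 * Real.sqrt (2 * configEnergy z)}.indicator (1 : Config (k + (m' + 1)) d (UnitAddTorus d) → ℝ) z₀ * |W z₀|) + 2 * 0)) +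
        |(m' + 1 : ℝ) * ∑ i : Fin k, ∫ p, ε ^ (Fintype.card d - 1) * max ⟪p.1.2 - (p.1.1 (Fin.castAdd m' i)).2, (p.2.1 : EuclideanSpace ℝ d)⟫_ℝ 0 *
          {v : EuclideanSpace ℝ d | ‖v - (p.1.1 (Fin.castAdd m' i)).2‖ ≤ V}.indicator (1 : EuclideanSpace ℝ d → ℝ) p.1.2 *
          (Alexander.good (Torus.geometry d) ε).indicator (fun w =>
            ((Alexander.regFlow (Torus.geometry d) ε (p.2.2) '' B).indicator (1 : Config k d (UnitAddTorus d) → ℝ) (w ∘ Fin.castAdd (m' + 1)) -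
              (Alexander.regFlow (Torus.geometry d) ε (p.2.2) '' B).indicator (1 : Config k d (UnitAddTorus d) → ℝ) (collidePair (Torus.geometry d) (Fin.castAdd (m' + 1) i) (Fin.natAdd k (Fin.last m')) w ∘ Fin.castAdd (m' + 1))) *
            W (Alexander.regFlow (Torus.geometry d) ε (-p.2.2) w)) (lossConfig (Torus.geometry d) ε p.1.1 (Fin.castAdd m' i) p.2.1 p.1.2) ∂((((volume : Measure (Config (k + m') d (UnitAddTorus d))).prod (volume : Measure (EuclideanSpace ℝ d))).prod ((((volume : Measure (EuclideanSpace ℝ d)).toSphere).prod ((volume : Measure ℝ).restrict (Ioc 0 t)))))) -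
          (m' + 1 : ℝ) * ∑ i : Fin k, ∫ p, ε ^ (Fintype.card d - 1) * max ⟪p.1.2 - (p.1.1 (Fin.castAdd m' i)).2, (p.2.1 : EuclideanSpace ℝ d)⟫_ℝ 0 *
          {v : EuclideanSpace ℝ d | ‖v - (p.1.1 (Fin.castAdd m' i)).2‖ ≤ V}.indicator (1 : EuclideanSpace ℝ d → ℝ) p.1.2 *
          (Alexander.good (Torus.geometry d) ε).indicator (fun w =>
            ((Alexander.regFlow (Torus.geometry d) ε (p.2.2) '' B).indicator (1 : Config k d (UnitAddTorus d) → ℝ) (w ∘ Fin.castAdd (m' + 1)) -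
              (Alexander.regFlow (Torus.geometry d) ε (p.2.2) '' B).indicator (1 : Config k d (UnitAddTorus d) → ℝ) (collidePair (Torus.geometry d) (Fin.castAdd (m' + 1) i) (Fin.natAdd k (Fin.last m')) w ∘ Fin.castAdd (m' + 1))) *
            W (Alexander.regFlow (Torus.geometry d) ε (-p.2.2) w)) (lossConfig (Torus.geometry d) ε p.1.1 (Fin.castAdd m' i) p.2.1 p.1.2) ∂((((volume : Measure (Config (k + m') d (UnitAddTorus d))).prod (volume : Measure (EuclideanSpace ℝ d))).prod ((((volume : Measure (EuclideanSpace ℝ d)).toSphere).prod ((volume : Measure ℝ).restrict (Ioc 0 t))))))|)) := by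
    refine ((hClim.const_mul 2).add (Tendsto.const_mul _ (tendsto_finsetSum _ fun i _ =>
      (tendsto_const_nhds.add ((hSlim i).const_mul 2))))).add ?_
    exact ((Tendsto.const_mul _ (tendsto_finsetSum _ fun i _ => hBlim i)).sub tendsto_const_nhds).abs
  have hfinal := ge_of_tendsto hRlim hstep
  rw [sub_self, abs_zero, add_zero, mul_zero, zero_add] at hfinal
  refine hfinal.trans (le_of_eq ?_)
  rw [Finset.mul_sum, Finset.mul_sum, Finset.mul_sum]
  refine Finset.sum_congr rfl fun i _ => ?_
  ring

end Weak

section NoCutoff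

variable {ε : ℝ} (hε : 0 < ε) (hε' : ε < 2⁻¹)

/-- **The velocity-moment Gaussian weight is integrable**: `(1 + ‖v_i‖) e^{-β E(Y)}` on
configurations (`‖v_i‖ ≤ 1 + E`, `(1 + E) e^{-βE} ≤ (1 + 2/β) e^{-βE/2}`). [folklore] -/
theorem integrable_one_add_norm_vel_mul_exp {n : ℕ} (i : Fin n) {β : ℝ} (hβ : 0 < β) :
    Integrable (fun Y : Config n d (UnitAddTorus d) => (1 + ‖(Y i).2‖) * Real.exp (-β * configEnergy Y)) := by
  have hint := (integrable_exp_neg_mul_configEnergy (d := d) (n := n) (b := β / 2) (by positivity)).const_mul (2 * (1 + 2 / β))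
  refine hint.mono' ?_ (Eventually.of_forall fun Y => ?_)
  · exact ((measurable_const.add ((measurable_pi_apply i).snd.norm)).mul
      ((measurable_const.mul (measurable_configEnergy' n)).exp)).aestronglyMeasurable
  · rw [Real.norm_eq_abs, abs_of_nonneg (by positivity)]
    have hE := norm_vel_sq_le_two_mul_configEnergy Y i
    have hE0 : 0 ≤ configEnergy Y := configEnergy_nonneg' Y
    have hx : 1 + ‖(Y i).2‖ ≤ 2 * (1 + configEnergy Y) := by nlinarith [norm_nonneg (Y i).2, sq_nonneg (‖(Y i).2‖ - 2)]
    have hexp : (1 + configEnergy Y) * Real.exp (-β * configEnergy Y) ≤ (1 + 2 / β) * Real.exp (-(β / 2) * configEnergy Y) := by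
      have h2 : Real.exp (-β * configEnergy Y) = Real.exp (-(β / 2) * configEnergy Y) * Real.exp (-(β / 2) * configEnergy Y) := by
        rw [← Real.exp_add]; congr 1; ring
      rw [h2, ← mul_assoc]
      refine mul_le_mul_of_nonneg_right ?_ (Real.exp_pos _).le
      have h3 : Real.exp (-(β / 2) * configEnergy Y) ≤ 1 := by
        rw [Real.exp_le_one_iff]; nlinarith
      have h4 : configEnergy Y * Real.exp (-(β / 2) * configEnergy Y) ≤ 2 / β := by
        have h5 : (β / 2) * configEnergy Y * Real.exp (-(β / 2) * configEnergy Y) ≤ 1 := by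
          have := Real.add_one_le_exp ((β / 2) * configEnergy Y)
          have h6 : 0 < Real.exp ((β / 2) * configEnergy Y) := Real.exp_pos _
          rw [show -(β / 2) * configEnergy Y = -((β / 2) * configEnergy Y) by ring, Real.exp_neg]
          rw [mul_inv_le_iff₀ h6]
          nlinarith
        have hβ2 : 0 < β / 2 := by positivity
        calc configEnergy Y * Real.exp (-(β / 2) * configEnergy Y)
            = ((β / 2) * configEnergy Y * Real.exp (-(β / 2) * configEnergy Y)) / (β / 2) := by
              field_simp
          _ ≤ 1 / (β / 2) := by gcongr
          _ = 2 / β := by field_simp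
      nlinarith [mul_nonneg hE0 (Real.exp_pos (-(β / 2) * configEnergy Y)).le]
    calc (1 + ‖(Y i).2‖) * Real.exp (-β * configEnergy Y)
        ≤ 2 * ((1 + configEnergy Y) * Real.exp (-β * configEnergy Y)) := by
          rw [← mul_assoc]; exact mul_le_mul_of_nonneg_right hx (Real.exp_pos _).le
      _ ≤ 2 * ((1 + 2 / β) * Real.exp (-(β / 2) * configEnergy Y)) := mul_le_mul_of_nonneg_left hexp (by norm_num)
      _ = 2 * (1 + 2 / β) * Real.exp (-(β / 2) * configEnergy Y) := by ring

/-- **The flux dominator without velocity cut-off is integrable** over the collision coordinates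
with bounded time: `(1 + ‖v_i‖) e^{-βE(Z')} · (1 + ‖v‖) e^{-β‖v‖²/2}`. [folklore] -/
theorem integrable_fluxDominator {k m' : ℕ} (i' : Fin (k + m')) {β : ℝ} (hβ : 0 < β) (t : ℝ) :
    Integrable (fun p : (Config (k + m') d (UnitAddTorus d) × EuclideanSpace ℝ d) × (sphere (0 : EuclideanSpace ℝ d) 1 × ℝ) => ((1 + ‖(p.1.1 i').2‖) * Real.exp (-β * configEnergy p.1.1)) *
      ((1 + ‖p.1.2‖) * Real.exp (-(β / 2) * ‖p.1.2‖ ^ 2))) ((((volume : Measure (Config (k + m') d (UnitAddTorus d))).prod (volume : Measure (EuclideanSpace ℝ d))).prod ((((volume : Measure (EuclideanSpace ℝ d)).toSphere).prod ((volume : Measure ℝ).restrict (Ioc 0 t)))))) := by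
  haveI hXE : SigmaFinite (volume : Measure (UnitAddTorus d × EuclideanSpace ℝ d)) := inferInstance
  haveI hC : SigmaFinite (volume : Measure (Config (k + m') d (UnitAddTorus d))) := inferInstance
  haveI hσf : IsFiniteMeasure ((volume : Measure (EuclideanSpace ℝ d)).toSphere) := inferInstance
  haveI hL : IsFiniteMeasure ((volume : Measure ℝ).restrict (Ioc 0 t)) := by
    refine ⟨?_⟩
    rw [Measure.restrict_apply_univ, Real.volume_Ioc]
    exact ENNReal.ofReal_lt_top
  have h1 := integrable_one_add_norm_vel_mul_exp (d := d) i' hβ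
  have h2 : Integrable (fun v : EuclideanSpace ℝ d => (1 + ‖v‖) * Real.exp (-(β / 2) * ‖v‖ ^ 2)) :=
    Literature.Analysis.FluidPDE.integrable_one_add_norm_mul_exp hβ
  have h12 := h1.mul_prod h2
  have h3 : Integrable (fun _ : sphere (0 : EuclideanSpace ℝ d) 1 × ℝ => (1 : ℝ))
      ((((volume : Measure (EuclideanSpace ℝ d)).toSphere).prod ((volume : Measure ℝ).restrict (Ioc 0 t)))) := integrable_const 1
  have h := h12.mul_prod h3
  refine h.congr (Filter.Eventually.of_forall fun p => ?_)
  simp only [mul_one]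

set_option maxHeartbeats 4000000 in
include hε hε' in
/-- **The weak one-step identity** (CIP 1994 Thm 4.3.1 in weak form, for a truncated weight):
letting the velocity cut-off `V → ∞` in `cutoff_weak_identity` (dominated convergence with the
Gaussian flux dominator `integrable_fluxDominator`; the fast error vanishes since every datum
has finite energy), the increment over `(0, t]` of `∫_{good} 1_{Φ^k_s B}(π Φ_s z₀) W(z₀) dz₀`
EQUALS `m` times the sum over the tagged labels of the clean flux integrals
`∫ ε^{d-1}(⟪v - v_i, ν⟫)₊ 1_{good}(w) (1_{Φ^k_{τ'}B}(π w) - 1_{Φ^k_{τ'}B}(π w')) W(Φ_{-τ'} w)`,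
`w = lossConfig Z' i ν v`, `w' = collidePair I L w`, `τ' ∈ (0, t]`. [cite: CIP1994, Thm 4.3.1] -/
theorem weak_identity [Nonempty d] [DecidableEq d] {k m' : ℕ} [NeZero k] {t : ℝ} (ht : 0 < t)
    {B : Set (Config k d (UnitAddTorus d))} (hB : MeasurableSet B) (hBg : B ⊆ Alexander.good (Torus.geometry d) ε)
    {W : Config (k + (m' + 1)) d (UnitAddTorus d) → ℝ} (hW : Measurable W)
    (hWσ : ∀ (J : Fin (m' + 1)) (z : Config (k + (m' + 1)) d (UnitAddTorus d)),
      W (z ∘ Equiv.swap (Fin.natAdd k J) (Fin.natAdd k (Fin.last m')) : Config (k + (m' + 1)) d (UnitAddTorus d)) = W z)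
    {CW β : ℝ} (hCW : 0 ≤ CW) (hβ : 0 < β) (hWb : ∀ z, |W z| ≤ CW * Real.exp (-β * configEnergy z))
    {M : ℕ} (hWM : ∀ z, M < Alexander.collisionCount (Torus.geometry d) ε z t → W z = 0) :
    (∫ z₀ in Alexander.good (Torus.geometry d) ε,
          (Alexander.regFlow (Torus.geometry d) ε (t) '' B).indicator (1 : Config k d (UnitAddTorus d) → ℝ) (Alexander.regFlow (Torus.geometry d) ε (t) z₀ ∘ Fin.castAdd (m' + 1)) * W z₀) -
        ∫ z₀ in Alexander.good (Torus.geometry d) ε, (Alexander.regFlow (Torus.geometry d) ε (0) '' B).indicator (1 : Config k d (UnitAddTorus d) → ℝ) (z₀ ∘ Fin.castAdd (m' + 1)) * W z₀ =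
      (m' + 1 : ℝ) * ∑ i : Fin k, ∫ p, ε ^ (Fintype.card d - 1) * max ⟪p.1.2 - (p.1.1 (Fin.castAdd m' i)).2, (p.2.1 : EuclideanSpace ℝ d)⟫_ℝ 0 *
          (Alexander.good (Torus.geometry d) ε).indicator (fun w =>
            ((Alexander.regFlow (Torus.geometry d) ε (p.2.2) '' B).indicator (1 : Config k d (UnitAddTorus d) → ℝ) (w ∘ Fin.castAdd (m' + 1)) -
              (Alexander.regFlow (Torus.geometry d) ε (p.2.2) '' B).indicator (1 : Config k d (UnitAddTorus d) → ℝ) (collidePair (Torus.geometry d) (Fin.castAdd (m' + 1) i) (Fin.natAdd k (Fin.last m')) w ∘ Fin.castAdd (m' + 1))) *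
            W (Alexander.regFlow (Torus.geometry d) ε (-p.2.2) w)) (lossConfig (Torus.geometry d) ε p.1.1 (Fin.castAdd m' i) p.2.1 p.1.2)
        ∂((((volume : Measure (Config (k + m') d (UnitAddTorus d))).prod (volume : Measure (EuclideanSpace ℝ d))).prod ((((volume : Measure (EuclideanSpace ℝ d)).toSphere).prod ((volume : Measure ℝ).restrict (Ioc 0 t)))))) := by
  classical
  haveI hXE : SigmaFinite (volume : Measure (UnitAddTorus d × EuclideanSpace ℝ d)) := inferInstance
  haveI hC : SigmaFinite (volume : Measure (Config (k + m') d (UnitAddTorus d))) := inferInstance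
  haveI hσf : IsFiniteMeasure ((volume : Measure (EuclideanSpace ℝ d)).toSphere) := inferInstance
  haveI : NeZero (k + m') := ⟨by have := NeZero.ne k; omega⟩
  have hG := Torus.isHardSphereRegular_geometry (d := d) hε'
  have hGm := Torus.isMeasurable_geometry (d := d)
  have hWi : Integrable W :=
    Integrable.mono' ((integrable_exp_neg_mul_configEnergy hβ).const_mul CW) hW.aestronglyMeasurable
      (Filter.Eventually.of_forall fun z => by rw [Real.norm_eq_abs]; exact hWb z)
  -- the chart radius
  set ρ : ℝ := (ε + 2⁻¹) / 2 with hρdef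
  have hρ : ρ < 1 / 2 := by rw [hρdef]; linarith
  have hερ : ε < ρ := by rw [hρdef]; linarith
  -- the identity with cut-off `V = m`
  have hcut : ∀ m : ℕ, |((∫ z₀ in Alexander.good (Torus.geometry d) ε,
          (Alexander.regFlow (Torus.geometry d) ε (t) '' B).indicator (1 : Config k d (UnitAddTorus d) → ℝ) (Alexander.regFlow (Torus.geometry d) ε (t) z₀ ∘ Fin.castAdd (m' + 1)) * W z₀) -
        ∫ z₀ in Alexander.good (Torus.geometry d) ε, (Alexander.regFlow (Torus.geometry d) ε (0) '' B).indicator (1 : Config k d (UnitAddTorus d) → ℝ) (z₀ ∘ Fin.castAdd (m' + 1)) * W z₀) -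
      (m' + 1 : ℝ) * ∑ i : Fin k, ∫ p, ε ^ (Fintype.card d - 1) * max ⟪p.1.2 - (p.1.1 (Fin.castAdd m' i)).2, (p.2.1 : EuclideanSpace ℝ d)⟫_ℝ 0 *
          {v : EuclideanSpace ℝ d | ‖v - (p.1.1 (Fin.castAdd m' i)).2‖ ≤ (m : ℝ)}.indicator (1 : EuclideanSpace ℝ d → ℝ) p.1.2 *
          (Alexander.good (Torus.geometry d) ε).indicator (fun w =>
            ((Alexander.regFlow (Torus.geometry d) ε (p.2.2) '' B).indicator (1 : Config k d (UnitAddTorus d) → ℝ) (w ∘ Fin.castAdd (m' + 1)) -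
              (Alexander.regFlow (Torus.geometry d) ε (p.2.2) '' B).indicator (1 : Config k d (UnitAddTorus d) → ℝ) (collidePair (Torus.geometry d) (Fin.castAdd (m' + 1) i) (Fin.natAdd k (Fin.last m')) w ∘ Fin.castAdd (m' + 1))) *
            W (Alexander.regFlow (Torus.geometry d) ε (-p.2.2) w)) (lossConfig (Torus.geometry d) ε p.1.1 (Fin.castAdd m' i) p.2.1 p.1.2)
        ∂((((volume : Measure (Config (k + m') d (UnitAddTorus d))).prod (volume : Measure (EuclideanSpace ℝ d))).prod ((((volume : Measure (EuclideanSpace ℝ d)).toSphere).prod ((volume : Measure ℝ).restrict (Ioc 0 t))))))| ≤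
      3 * ((m' + 1 : ℝ) * ∑ _i : Fin k, (M : ℝ) * ∫ z₀ in Alexander.good (Torus.geometry d) ε,
        {z : Config (k + (m' + 1)) d (UnitAddTorus d) | (m : ℝ) < 2 * Real.sqrt (2 * configEnergy z)}.indicator (1 : Config (k + (m' + 1)) d (UnitAddTorus d) → ℝ) z₀ * |W z₀|) := fun m =>
    cutoff_weak_identity hε hε' (V := (m : ℝ)) ht (Nat.cast_nonneg m) hρ hερ hB hBg hW hWσ hCW hβ hWb hWM
  -- the fast error vanishes as `V = m → ∞`
  have hgoodm := Alexander.measurableSet_good (N := k + (m' + 1)) hG hGm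
  have hEnm : ∀ m : ℕ, MeasurableSet {z : Config (k + (m' + 1)) d (UnitAddTorus d) | (m : ℝ) < 2 * Real.sqrt (2 * configEnergy z)} := fun m =>
    measurableSet_lt measurable_const (measurable_const.mul ((measurable_const.mul (measurable_configEnergy' _)).sqrt))
  have hfastlim : Tendsto (fun m : ℕ => ∫ z₀ in Alexander.good (Torus.geometry d) ε,
        {z : Config (k + (m' + 1)) d (UnitAddTorus d) | (m : ℝ) < 2 * Real.sqrt (2 * configEnergy z)}.indicator (1 : Config (k + (m' + 1)) d (UnitAddTorus d) → ℝ) z₀ * |W z₀|) atTop (𝓝 0) := by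
    have h := tendsto_integral_of_dominated_convergence (μ := volume.restrict (Alexander.good (Torus.geometry d) ε))
      (F := fun (m : ℕ) (z₀ : Config (k + (m' + 1)) d (UnitAddTorus d)) => {z : Config (k + (m' + 1)) d (UnitAddTorus d) | (m : ℝ) < 2 * Real.sqrt (2 * configEnergy z)}.indicator (1 : Config (k + (m' + 1)) d (UnitAddTorus d) → ℝ) z₀ * |W z₀|)
      (f := fun _ => (0 : ℝ)) (fun z₀ => |W z₀|)
      (fun m => ((measurable_const.indicator (hEnm m)).mul (continuous_abs.measurable.comp hW)).aestronglyMeasurable)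
      hWi.abs.integrableOn
      (fun m => ae_of_all _ fun z₀ => by
        rw [Real.norm_eq_abs, abs_mul, abs_abs]
        refine mul_le_of_le_one_left (abs_nonneg _) ?_
        by_cases h : z₀ ∈ {z : Config (k + (m' + 1)) d (UnitAddTorus d) | (m : ℝ) < 2 * Real.sqrt (2 * configEnergy z)}
        · rw [indicator_of_mem h, Pi.one_apply, abs_one]
        · rw [indicator_of_notMem h, abs_zero]; exact zero_le_one)
      (ae_of_all _ fun z₀ => by
        have hEq : ∀ᶠ m : ℕ in atTop, {z : Config (k + (m' + 1)) d (UnitAddTorus d) | (m : ℝ) < 2 * Real.sqrt (2 * configEnergy z)}.indicator (1 : Config (k + (m' + 1)) d (UnitAddTorus d) → ℝ) z₀ * |W z₀| = 0 := by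
          obtain ⟨m₀, hm₀⟩ := exists_nat_ge (2 * Real.sqrt (2 * configEnergy z₀))
          filter_upwards [Filter.eventually_ge_atTop m₀] with m hm
          rw [indicator_of_notMem, zero_mul]
          intro h
          have h' : (m : ℝ) < 2 * Real.sqrt (2 * configEnergy z₀) := h
          have : (m₀ : ℝ) ≤ m := by exact_mod_cast hm
          linarith
        exact tendsto_const_nhds.congr' (hEq.mono fun m hm => hm.symm))
    simpa using h
  -- the flux integrals converge as `V = m → ∞`
  have hZ : Measurable fun p : (Config (k + m') d (UnitAddTorus d) × EuclideanSpace ℝ d) × (sphere (0 : EuclideanSpace ℝ d) 1 × ℝ) => p.1.1 := measurable_fst.fst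
  have hv : Measurable fun p : (Config (k + m') d (UnitAddTorus d) × EuclideanSpace ℝ d) × (sphere (0 : EuclideanSpace ℝ d) 1 × ℝ) => p.1.2 := measurable_fst.snd
  have hν : Measurable fun p : (Config (k + m') d (UnitAddTorus d) × EuclideanSpace ℝ d) × (sphere (0 : EuclideanSpace ℝ d) 1 × ℝ) => (p.2.1 : EuclideanSpace ℝ d) := continuous_subtype_val.measurable.comp measurable_snd.fst
  have hτ : Measurable fun p : (Config (k + m') d (UnitAddTorus d) × EuclideanSpace ℝ d) × (sphere (0 : EuclideanSpace ℝ d) 1 × ℝ) => p.2.2 := measurable_snd.snd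
  have hfluxlim : ∀ i : Fin k, Tendsto (fun m : ℕ => ∫ p, ε ^ (Fintype.card d - 1) * max ⟪p.1.2 - (p.1.1 (Fin.castAdd m' i)).2, (p.2.1 : EuclideanSpace ℝ d)⟫_ℝ 0 *
          {v : EuclideanSpace ℝ d | ‖v - (p.1.1 (Fin.castAdd m' i)).2‖ ≤ (m : ℝ)}.indicator (1 : EuclideanSpace ℝ d → ℝ) p.1.2 *
          (Alexander.good (Torus.geometry d) ε).indicator (fun w =>
            ((Alexander.regFlow (Torus.geometry d) ε (p.2.2) '' B).indicator (1 : Config k d (UnitAddTorus d) → ℝ) (w ∘ Fin.castAdd (m' + 1)) -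
              (Alexander.regFlow (Torus.geometry d) ε (p.2.2) '' B).indicator (1 : Config k d (UnitAddTorus d) → ℝ) (collidePair (Torus.geometry d) (Fin.castAdd (m' + 1) i) (Fin.natAdd k (Fin.last m')) w ∘ Fin.castAdd (m' + 1))) *
            W (Alexander.regFlow (Torus.geometry d) ε (-p.2.2) w)) (lossConfig (Torus.geometry d) ε p.1.1 (Fin.castAdd m' i) p.2.1 p.1.2) ∂((((volume : Measure (Config (k + m') d (UnitAddTorus d))).prod (volume : Measure (EuclideanSpace ℝ d))).prod ((((volume : Measure (EuclideanSpace ℝ d)).toSphere).prod ((volume : Measure ℝ).restrict (Ioc 0 t))))))) atTop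
      (𝓝 (∫ p, ε ^ (Fintype.card d - 1) * max ⟪p.1.2 - (p.1.1 (Fin.castAdd m' i)).2, (p.2.1 : EuclideanSpace ℝ d)⟫_ℝ 0 *
          (Alexander.good (Torus.geometry d) ε).indicator (fun w =>
            ((Alexander.regFlow (Torus.geometry d) ε (p.2.2) '' B).indicator (1 : Config k d (UnitAddTorus d) → ℝ) (w ∘ Fin.castAdd (m' + 1)) -
              (Alexander.regFlow (Torus.geometry d) ε (p.2.2) '' B).indicator (1 : Config k d (UnitAddTorus d) → ℝ) (collidePair (Torus.geometry d) (Fin.castAdd (m' + 1) i) (Fin.natAdd k (Fin.last m')) w ∘ Fin.castAdd (m' + 1))) *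
            W (Alexander.regFlow (Torus.geometry d) ε (-p.2.2) w)) (lossConfig (Torus.geometry d) ε p.1.1 (Fin.castAdd m' i) p.2.1 p.1.2) ∂((((volume : Measure (Config (k + m') d (UnitAddTorus d))).prod (volume : Measure (EuclideanSpace ℝ d))).prod ((((volume : Measure (EuclideanSpace ℝ d)).toSphere).prod ((volume : Measure ℝ).restrict (Ioc 0 t)))))))) := by
    intro i
    set I : Fin (k + (m' + 1)) := Fin.castAdd (m' + 1) i with hI
    set L : Fin (k + (m' + 1)) := Fin.natAdd k (Fin.last m') with hL
    set i' : Fin (k + m') := Fin.castAdd m' i with hi'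
    set body : ℝ → Config (k + (m' + 1)) d (UnitAddTorus d) → ℝ := fun τ w =>
      ((Alexander.regFlow (Torus.geometry d) ε τ '' B).indicator (1 : Config k d (UnitAddTorus d) → ℝ) (w ∘ Fin.castAdd (m' + 1)) -
        (Alexander.regFlow (Torus.geometry d) ε τ '' B).indicator (1 : Config k d (UnitAddTorus d) → ℝ) (collidePair (Torus.geometry d) I L w ∘ Fin.castAdd (m' + 1))) *
      W (Alexander.regFlow (Torus.geometry d) ε (-τ) w) with hbody
    set loss : (Config (k + m') d (UnitAddTorus d) × EuclideanSpace ℝ d) × (sphere (0 : EuclideanSpace ℝ d) 1 × ℝ) → Config (k + (m' + 1)) d (UnitAddTorus d) := fun p => (lossConfig (Torus.geometry d) ε p.1.1 (Fin.castAdd m' i) p.2.1 p.1.2) with hloss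
    set flux : (Config (k + m') d (UnitAddTorus d) × EuclideanSpace ℝ d) × (sphere (0 : EuclideanSpace ℝ d) 1 × ℝ) → ℝ := fun p => ε ^ (Fintype.card d - 1) * max ⟪p.1.2 - (p.1.1 i').2, (p.2.1 : EuclideanSpace ℝ d)⟫_ℝ 0 with hflux
    set gb : (Config (k + m') d (UnitAddTorus d) × EuclideanSpace ℝ d) × (sphere (0 : EuclideanSpace ℝ d) 1 × ℝ) → ℝ := fun p => (Alexander.good (Torus.geometry d) ε).indicator (body p.2.2) (loss p) with hgb
    set Gm : ℕ → (Config (k + m') d (UnitAddTorus d) × EuclideanSpace ℝ d) × (sphere (0 : EuclideanSpace ℝ d) 1 × ℝ) → ℝ := fun m p => flux p * {v : EuclideanSpace ℝ d | ‖v - (p.1.1 i').2‖ ≤ (m : ℝ)}.indicator (1 : EuclideanSpace ℝ d → ℝ) p.1.2 * gb p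
      with hGmdef
    set G0 : (Config (k + m') d (UnitAddTorus d) × EuclideanSpace ℝ d) × (sphere (0 : EuclideanSpace ℝ d) 1 × ℝ) → ℝ := fun p => flux p * gb p with hG0
    show Tendsto (fun m : ℕ => ∫ p, Gm m p ∂((((volume : Measure (Config (k + m') d (UnitAddTorus d))).prod (volume : Measure (EuclideanSpace ℝ d))).prod ((((volume : Measure (EuclideanSpace ℝ d)).toSphere).prod ((volume : Measure ℝ).restrict (Ioc 0 t))))))) atTop (𝓝 (∫ p, G0 p ∂((((volume : Measure (Config (k + m') d (UnitAddTorus d))).prod (volume : Measure (EuclideanSpace ℝ d))).prod ((((volume : Measure (EuclideanSpace ℝ d)).toSphere).prod ((volume : Measure ℝ).restrict (Ioc 0 t))))))))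
    -- bounds
    have hind01k : ∀ (S : Set (Config k d (UnitAddTorus d))) (y : Config k d (UnitAddTorus d)), 0 ≤ S.indicator (1 : Config k d (UnitAddTorus d) → ℝ) y ∧ S.indicator (1 : Config k d (UnitAddTorus d) → ℝ) y ≤ 1 := by
      intro S y
      by_cases h : y ∈ S
      · rw [indicator_of_mem h, Pi.one_apply]; exact ⟨zero_le_one, le_rfl⟩
      · rw [indicator_of_notMem h]; exact ⟨le_rfl, zero_le_one⟩
    have hgb_le : ∀ p, |gb p| ≤ CW * Real.exp (-β * configEnergy (loss p)) := by
      intro p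
      simp only [hgb]
      by_cases hg : loss p ∈ Alexander.good (Torus.geometry d) ε
      · rw [indicator_of_mem hg]
        simp only [hbody]
        rw [abs_mul]
        have h1 := hind01k (Alexander.regFlow (Torus.geometry d) ε p.2.2 '' B) (loss p ∘ Fin.castAdd (m' + 1))
        have h2 := hind01k (Alexander.regFlow (Torus.geometry d) ε p.2.2 '' B) (collidePair (Torus.geometry d) I L (loss p) ∘ Fin.castAdd (m' + 1))
        have hbr : |(Alexander.regFlow (Torus.geometry d) ε p.2.2 '' B).indicator (1 : Config k d (UnitAddTorus d) → ℝ) (loss p ∘ Fin.castAdd (m' + 1)) -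
            (Alexander.regFlow (Torus.geometry d) ε p.2.2 '' B).indicator (1 : Config k d (UnitAddTorus d) → ℝ) (collidePair (Torus.geometry d) I L (loss p) ∘ Fin.castAdd (m' + 1))| ≤ 1 := by
          rw [abs_le]; constructor <;> linarith [h1.1, h1.2, h2.1, h2.2]
        have hWw := hWb (Alexander.regFlow (Torus.geometry d) ε (-p.2.2) (loss p))
        rw [Alexander.configEnergy_regFlow] at hWw
        calc _ ≤ 1 * (CW * Real.exp (-β * configEnergy (loss p))) := mul_le_mul hbr hWw (abs_nonneg _) zero_le_one
          _ = _ := one_mul _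
      · rw [indicator_of_notMem hg, abs_zero]; positivity
    have hflux_le : ∀ p : (Config (k + m') d (UnitAddTorus d) × EuclideanSpace ℝ d) × (sphere (0 : EuclideanSpace ℝ d) 1 × ℝ), |flux p| ≤ ε ^ (Fintype.card d - 1) * ((1 + ‖(p.1.1 i').2‖) * (1 + ‖p.1.2‖)) := by
      intro p
      simp only [hflux]
      have hεp : 0 ≤ ε ^ (Fintype.card d - 1) := pow_nonneg hε.le _
      rw [abs_of_nonneg (mul_nonneg hεp (le_max_right _ _))]
      refine mul_le_mul_of_nonneg_left ?_ hεp
      refine max_le ?_ (by positivity)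
      calc ⟪p.1.2 - (p.1.1 i').2, (p.2.1 : EuclideanSpace ℝ d)⟫_ℝ ≤ ‖p.1.2 - (p.1.1 i').2‖ * ‖(p.2.1 : EuclideanSpace ℝ d)‖ := real_inner_le_norm _ _
        _ = ‖p.1.2 - (p.1.1 i').2‖ := by rw [norm_eq_of_mem_sphere p.2.1, mul_one]
        _ ≤ ‖p.1.2‖ + ‖(p.1.1 i').2‖ := norm_sub_le _ _
        _ ≤ (1 + ‖(p.1.1 i').2‖) * (1 + ‖p.1.2‖) := by nlinarith [norm_nonneg p.1.2, norm_nonneg (p.1.1 i').2]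
    -- the dominator
    set Dom : (Config (k + m') d (UnitAddTorus d) × EuclideanSpace ℝ d) × (sphere (0 : EuclideanSpace ℝ d) 1 × ℝ) → ℝ := fun p => ε ^ (Fintype.card d - 1) * CW * (((1 + ‖(p.1.1 i').2‖) * Real.exp (-β * configEnergy p.1.1)) *
      ((1 + ‖p.1.2‖) * Real.exp (-(β / 2) * ‖p.1.2‖ ^ 2))) with hDom
    have hDomi : Integrable Dom ((((volume : Measure (Config (k + m') d (UnitAddTorus d))).prod (volume : Measure (EuclideanSpace ℝ d))).prod ((((volume : Measure (EuclideanSpace ℝ d)).toSphere).prod ((volume : Measure ℝ).restrict (Ioc 0 t)))))) :=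
      (integrable_fluxDominator (d := d) (k := k) (m' := m') i' hβ t).const_mul (ε ^ (Fintype.card d - 1) * CW)
    have hG0_le : ∀ p, |G0 p| ≤ Dom p := by
      intro p
      simp only [hG0, hDom]
      rw [abs_mul]
      have h1 := hflux_le p
      have h2 := hgb_le p
      have hexp : Real.exp (-β * configEnergy (loss p)) = Real.exp (-β * configEnergy p.1.1) * Real.exp (-(β / 2) * ‖p.1.2‖ ^ 2) := by
        simp only [hloss]
        rw [configEnergy_lossConfig, ← Real.exp_add]; congr 1; ring
      rw [hexp] at h2
      calc |flux p| * |gb p| ≤ (ε ^ (Fintype.card d - 1) * ((1 + ‖(p.1.1 i').2‖) * (1 + ‖p.1.2‖))) *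
            (CW * (Real.exp (-β * configEnergy p.1.1) * Real.exp (-(β / 2) * ‖p.1.2‖ ^ 2))) :=
            mul_le_mul h1 h2 (abs_nonneg _) (by positivity)
        _ = _ := by ring
    have hGm_le : ∀ m p, |Gm m p| ≤ Dom p := by
      intro m p
      refine le_trans ?_ (hG0_le p)
      have h01 : |{v : EuclideanSpace ℝ d | ‖v - (p.1.1 i').2‖ ≤ (m : ℝ)}.indicator (1 : EuclideanSpace ℝ d → ℝ) p.1.2| ≤ 1 := by
        by_cases h : p.1.2 ∈ {v : EuclideanSpace ℝ d | ‖v - (p.1.1 i').2‖ ≤ (m : ℝ)}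
        · rw [indicator_of_mem h, Pi.one_apply, abs_one]
        · rw [indicator_of_notMem h, abs_zero]; exact zero_le_one
      have heq : Gm m p = {v : EuclideanSpace ℝ d | ‖v - (p.1.1 i').2‖ ≤ (m : ℝ)}.indicator (1 : EuclideanSpace ℝ d → ℝ) p.1.2 * G0 p := by
        simp only [hGmdef, hG0]; ring
      rw [heq, abs_mul]
      exact mul_le_of_le_one_left (abs_nonneg _) h01
    -- measurability
    have hvi : Measurable fun p : (Config (k + m') d (UnitAddTorus d) × EuclideanSpace ℝ d) × (sphere (0 : EuclideanSpace ℝ d) 1 × ℝ) => (p.1.1 i').2 := ((measurable_pi_apply i').comp hZ).snd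
    have hfluxm : Measurable flux := by
      simp only [hflux]; exact measurable_const.mul (((hv.sub hvi).inner hν).max measurable_const)
    have hlossm : Measurable loss := by simp only [hloss]; exact measurable_lossConfig hGm.measurable_translate ε i' hZ hν hv
    have hbodym : ∀ (S : Set (Config (k + (m' + 1)) d (UnitAddTorus d))), MeasurableSet S → Measurable fun q : ℝ × Config (k + (m' + 1)) d (UnitAddTorus d) => S.indicator (body q.1) q.2 := by
      intro S hS
      have h := measurable_eventIntegrand hε hε' I L 0 hB hW hS
      simp only [zero_add] at h
      simpa only [hbody] using h
    have hgbm : Measurable gb := by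
      have h := (hbodym _ hgoodm).comp (hτ.prodMk hlossm)
      simp only [hgb]; exact h
    have hslowm : ∀ m : ℕ, Measurable fun p : (Config (k + m') d (UnitAddTorus d) × EuclideanSpace ℝ d) × (sphere (0 : EuclideanSpace ℝ d) 1 × ℝ) => {v : EuclideanSpace ℝ d | ‖v - (p.1.1 i').2‖ ≤ (m : ℝ)}.indicator (1 : EuclideanSpace ℝ d → ℝ) p.1.2 := by
      intro m
      have hslowS : MeasurableSet {p : (Config (k + m') d (UnitAddTorus d) × EuclideanSpace ℝ d) × (sphere (0 : EuclideanSpace ℝ d) 1 × ℝ) | ‖p.1.2 - (p.1.1 i').2‖ ≤ (m : ℝ)} := measurableSet_le (hv.sub hvi).norm measurable_const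
      have hslow_eq : ∀ p : (Config (k + m') d (UnitAddTorus d) × EuclideanSpace ℝ d) × (sphere (0 : EuclideanSpace ℝ d) 1 × ℝ), {v : EuclideanSpace ℝ d | ‖v - (p.1.1 i').2‖ ≤ (m : ℝ)}.indicator (1 : EuclideanSpace ℝ d → ℝ) p.1.2 =
          {p : (Config (k + m') d (UnitAddTorus d) × EuclideanSpace ℝ d) × (sphere (0 : EuclideanSpace ℝ d) 1 × ℝ) | ‖p.1.2 - (p.1.1 i').2‖ ≤ (m : ℝ)}.indicator (1 : (Config (k + m') d (UnitAddTorus d) × EuclideanSpace ℝ d) × (sphere (0 : EuclideanSpace ℝ d) 1 × ℝ) → ℝ) p := by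
        intro p
        by_cases h : ‖p.1.2 - (p.1.1 i').2‖ ≤ (m : ℝ)
        · rw [indicator_of_mem (show p.1.2 ∈ {v : EuclideanSpace ℝ d | ‖v - (p.1.1 i').2‖ ≤ (m : ℝ)} from h),
            indicator_of_mem (show p ∈ {p : (Config (k + m') d (UnitAddTorus d) × EuclideanSpace ℝ d) × (sphere (0 : EuclideanSpace ℝ d) 1 × ℝ) | ‖p.1.2 - (p.1.1 i').2‖ ≤ (m : ℝ)} from h)]; simp
        · rw [indicator_of_notMem (show p.1.2 ∉ {v : EuclideanSpace ℝ d | ‖v - (p.1.1 i').2‖ ≤ (m : ℝ)} from h),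
            indicator_of_notMem (show p ∉ {p : (Config (k + m') d (UnitAddTorus d) × EuclideanSpace ℝ d) × (sphere (0 : EuclideanSpace ℝ d) 1 × ℝ) | ‖p.1.2 - (p.1.1 i').2‖ ≤ (m : ℝ)} from h)]
      simp_rw [hslow_eq]; exact measurable_const.indicator hslowS
    have hGmm : ∀ m, Measurable (Gm m) := by
      intro m
      have h := (hfluxm.mul (hslowm m)).mul hgbm
      simp only [hGmdef]; exact h
    -- pointwise: eventually no cut-off
    have hlim : ∀ᵐ p ∂((((volume : Measure (Config (k + m') d (UnitAddTorus d))).prod (volume : Measure (EuclideanSpace ℝ d))).prod ((((volume : Measure (EuclideanSpace ℝ d)).toSphere).prod ((volume : Measure ℝ).restrict (Ioc 0 t)))))), Tendsto (fun m => Gm m p) atTop (𝓝 (G0 p)) := by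
      refine ae_of_all _ fun p => ?_
      have hEq : ∀ᶠ m : ℕ in atTop, Gm m p = G0 p := by
        obtain ⟨m₀, hm₀⟩ := exists_nat_ge ‖p.1.2 - (p.1.1 i').2‖
        filter_upwards [Filter.eventually_ge_atTop m₀] with m hm
        simp only [hGmdef, hG0]
        rw [indicator_of_mem, Pi.one_apply, mul_one]
        show ‖p.1.2 - (p.1.1 i').2‖ ≤ (m : ℝ)
        have : (m₀ : ℝ) ≤ m := by exact_mod_cast hm
        linarith
      exact tendsto_const_nhds.congr' (hEq.mono fun m hm => hm.symm)
    exact tendsto_integral_of_dominated_convergence Dom (fun m => (hGmm m).aestronglyMeasurable) hDomi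
      (fun m => ae_of_all _ fun p => by rw [Real.norm_eq_abs]; exact hGm_le m p) hlim
  -- conclusion: the distance tends to `0`
  have hR : Tendsto (fun m : ℕ => 3 * ((m' + 1 : ℝ) * ∑ _i : Fin k, (M : ℝ) * ∫ z₀ in Alexander.good (Torus.geometry d) ε,
        {z : Config (k + (m' + 1)) d (UnitAddTorus d) | (m : ℝ) < 2 * Real.sqrt (2 * configEnergy z)}.indicator (1 : Config (k + (m' + 1)) d (UnitAddTorus d) → ℝ) z₀ * |W z₀|) +
      |(m' + 1 : ℝ) * ∑ i : Fin k, ∫ p, ε ^ (Fintype.card d - 1) * max ⟪p.1.2 - (p.1.1 (Fin.castAdd m' i)).2, (p.2.1 : EuclideanSpace ℝ d)⟫_ℝ 0 *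
          {v : EuclideanSpace ℝ d | ‖v - (p.1.1 (Fin.castAdd m' i)).2‖ ≤ (m : ℝ)}.indicator (1 : EuclideanSpace ℝ d → ℝ) p.1.2 *
          (Alexander.good (Torus.geometry d) ε).indicator (fun w =>
            ((Alexander.regFlow (Torus.geometry d) ε (p.2.2) '' B).indicator (1 : Config k d (UnitAddTorus d) → ℝ) (w ∘ Fin.castAdd (m' + 1)) -
              (Alexander.regFlow (Torus.geometry d) ε (p.2.2) '' B).indicator (1 : Config k d (UnitAddTorus d) → ℝ) (collidePair (Torus.geometry d) (Fin.castAdd (m' + 1) i) (Fin.natAdd k (Fin.last m')) w ∘ Fin.castAdd (m' + 1))) *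
            W (Alexander.regFlow (Torus.geometry d) ε (-p.2.2) w)) (lossConfig (Torus.geometry d) ε p.1.1 (Fin.castAdd m' i) p.2.1 p.1.2) ∂((((volume : Measure (Config (k + m') d (UnitAddTorus d))).prod (volume : Measure (EuclideanSpace ℝ d))).prod ((((volume : Measure (EuclideanSpace ℝ d)).toSphere).prod ((volume : Measure ℝ).restrict (Ioc 0 t)))))) -
        (m' + 1 : ℝ) * ∑ i : Fin k, ∫ p, ε ^ (Fintype.card d - 1) * max ⟪p.1.2 - (p.1.1 (Fin.castAdd m' i)).2, (p.2.1 : EuclideanSpace ℝ d)⟫_ℝ 0 *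
          (Alexander.good (Torus.geometry d) ε).indicator (fun w =>
            ((Alexander.regFlow (Torus.geometry d) ε (p.2.2) '' B).indicator (1 : Config k d (UnitAddTorus d) → ℝ) (w ∘ Fin.castAdd (m' + 1)) -
              (Alexander.regFlow (Torus.geometry d) ε (p.2.2) '' B).indicator (1 : Config k d (UnitAddTorus d) → ℝ) (collidePair (Torus.geometry d) (Fin.castAdd (m' + 1) i) (Fin.natAdd k (Fin.last m')) w ∘ Fin.castAdd (m' + 1))) *
            W (Alexander.regFlow (Torus.geometry d) ε (-p.2.2) w)) (lossConfig (Torus.geometry d) ε p.1.1 (Fin.castAdd m' i) p.2.1 p.1.2) ∂((((volume : Measure (Config (k + m') d (UnitAddTorus d))).prod (volume : Measure (EuclideanSpace ℝ d))).prod ((((volume : Measure (EuclideanSpace ℝ d)).toSphere).prod ((volume : Measure ℝ).restrict (Ioc 0 t))))))|) atTop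
      (𝓝 (3 * ((m' + 1 : ℝ) * ∑ _i : Fin k, (M : ℝ) * 0) +
        |(m' + 1 : ℝ) * ∑ i : Fin k, ∫ p, ε ^ (Fintype.card d - 1) * max ⟪p.1.2 - (p.1.1 (Fin.castAdd m' i)).2, (p.2.1 : EuclideanSpace ℝ d)⟫_ℝ 0 *
          (Alexander.good (Torus.geometry d) ε).indicator (fun w =>
            ((Alexander.regFlow (Torus.geometry d) ε (p.2.2) '' B).indicator (1 : Config k d (UnitAddTorus d) → ℝ) (w ∘ Fin.castAdd (m' + 1)) -
              (Alexander.regFlow (Torus.geometry d) ε (p.2.2) '' B).indicator (1 : Config k d (UnitAddTorus d) → ℝ) (collidePair (Torus.geometry d) (Fin.castAdd (m' + 1) i) (Fin.natAdd k (Fin.last m')) w ∘ Fin.castAdd (m' + 1))) *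
            W (Alexander.regFlow (Torus.geometry d) ε (-p.2.2) w)) (lossConfig (Torus.geometry d) ε p.1.1 (Fin.castAdd m' i) p.2.1 p.1.2) ∂((((volume : Measure (Config (k + m') d (UnitAddTorus d))).prod (volume : Measure (EuclideanSpace ℝ d))).prod ((((volume : Measure (EuclideanSpace ℝ d)).toSphere).prod ((volume : Measure ℝ).restrict (Ioc 0 t)))))) -
          (m' + 1 : ℝ) * ∑ i : Fin k, ∫ p, ε ^ (Fintype.card d - 1) * max ⟪p.1.2 - (p.1.1 (Fin.castAdd m' i)).2, (p.2.1 : EuclideanSpace ℝ d)⟫_ℝ 0 *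
          (Alexander.good (Torus.geometry d) ε).indicator (fun w =>
            ((Alexander.regFlow (Torus.geometry d) ε (p.2.2) '' B).indicator (1 : Config k d (UnitAddTorus d) → ℝ) (w ∘ Fin.castAdd (m' + 1)) -
              (Alexander.regFlow (Torus.geometry d) ε (p.2.2) '' B).indicator (1 : Config k d (UnitAddTorus d) → ℝ) (collidePair (Torus.geometry d) (Fin.castAdd (m' + 1) i) (Fin.natAdd k (Fin.last m')) w ∘ Fin.castAdd (m' + 1))) *
            W (Alexander.regFlow (Torus.geometry d) ε (-p.2.2) w)) (lossConfig (Torus.geometry d) ε p.1.1 (Fin.castAdd m' i) p.2.1 p.1.2) ∂((((volume : Measure (Config (k + m') d (UnitAddTorus d))).prod (volume : Measure (EuclideanSpace ℝ d))).prod ((((volume : Measure (EuclideanSpace ℝ d)).toSphere).prod ((volume : Measure ℝ).restrict (Ioc 0 t))))))|)) := by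
    refine (Tendsto.const_mul 3 (Tendsto.const_mul _ (tendsto_finsetSum _ fun i _ => hfastlim.const_mul _))).add ?_
    exact ((Tendsto.const_mul _ (tendsto_finsetSum _ fun i _ => hfluxlim i)).sub tendsto_const_nhds).abs
  have hle : ∀ m : ℕ, |((∫ z₀ in Alexander.good (Torus.geometry d) ε,
          (Alexander.regFlow (Torus.geometry d) ε (t) '' B).indicator (1 : Config k d (UnitAddTorus d) → ℝ) (Alexander.regFlow (Torus.geometry d) ε (t) z₀ ∘ Fin.castAdd (m' + 1)) * W z₀) -
        ∫ z₀ in Alexander.good (Torus.geometry d) ε, (Alexander.regFlow (Torus.geometry d) ε (0) '' B).indicator (1 : Config k d (UnitAddTorus d) → ℝ) (z₀ ∘ Fin.castAdd (m' + 1)) * W z₀) -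
      (m' + 1 : ℝ) * ∑ i : Fin k, ∫ p, ε ^ (Fintype.card d - 1) * max ⟪p.1.2 - (p.1.1 (Fin.castAdd m' i)).2, (p.2.1 : EuclideanSpace ℝ d)⟫_ℝ 0 *
          (Alexander.good (Torus.geometry d) ε).indicator (fun w =>
            ((Alexander.regFlow (Torus.geometry d) ε (p.2.2) '' B).indicator (1 : Config k d (UnitAddTorus d) → ℝ) (w ∘ Fin.castAdd (m' + 1)) -
              (Alexander.regFlow (Torus.geometry d) ε (p.2.2) '' B).indicator (1 : Config k d (UnitAddTorus d) → ℝ) (collidePair (Torus.geometry d) (Fin.castAdd (m' + 1) i) (Fin.natAdd k (Fin.last m')) w ∘ Fin.castAdd (m' + 1))) *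
            W (Alexander.regFlow (Torus.geometry d) ε (-p.2.2) w)) (lossConfig (Torus.geometry d) ε p.1.1 (Fin.castAdd m' i) p.2.1 p.1.2) ∂((((volume : Measure (Config (k + m') d (UnitAddTorus d))).prod (volume : Measure (EuclideanSpace ℝ d))).prod ((((volume : Measure (EuclideanSpace ℝ d)).toSphere).prod ((volume : Measure ℝ).restrict (Ioc 0 t))))))| ≤
      3 * ((m' + 1 : ℝ) * ∑ _i : Fin k, (M : ℝ) * ∫ z₀ in Alexander.good (Torus.geometry d) ε,
        {z : Config (k + (m' + 1)) d (UnitAddTorus d) | (m : ℝ) < 2 * Real.sqrt (2 * configEnergy z)}.indicator (1 : Config (k + (m' + 1)) d (UnitAddTorus d) → ℝ) z₀ * |W z₀|) +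
      |(m' + 1 : ℝ) * ∑ i : Fin k, ∫ p, ε ^ (Fintype.card d - 1) * max ⟪p.1.2 - (p.1.1 (Fin.castAdd m' i)).2, (p.2.1 : EuclideanSpace ℝ d)⟫_ℝ 0 *
          {v : EuclideanSpace ℝ d | ‖v - (p.1.1 (Fin.castAdd m' i)).2‖ ≤ (m : ℝ)}.indicator (1 : EuclideanSpace ℝ d → ℝ) p.1.2 *
          (Alexander.good (Torus.geometry d) ε).indicator (fun w =>
            ((Alexander.regFlow (Torus.geometry d) ε (p.2.2) '' B).indicator (1 : Config k d (UnitAddTorus d) → ℝ) (w ∘ Fin.castAdd (m' + 1)) -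
              (Alexander.regFlow (Torus.geometry d) ε (p.2.2) '' B).indicator (1 : Config k d (UnitAddTorus d) → ℝ) (collidePair (Torus.geometry d) (Fin.castAdd (m' + 1) i) (Fin.natAdd k (Fin.last m')) w ∘ Fin.castAdd (m' + 1))) *
            W (Alexander.regFlow (Torus.geometry d) ε (-p.2.2) w)) (lossConfig (Torus.geometry d) ε p.1.1 (Fin.castAdd m' i) p.2.1 p.1.2) ∂((((volume : Measure (Config (k + m') d (UnitAddTorus d))).prod (volume : Measure (EuclideanSpace ℝ d))).prod ((((volume : Measure (EuclideanSpace ℝ d)).toSphere).prod ((volume : Measure ℝ).restrict (Ioc 0 t)))))) -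
        (m' + 1 : ℝ) * ∑ i : Fin k, ∫ p, ε ^ (Fintype.card d - 1) * max ⟪p.1.2 - (p.1.1 (Fin.castAdd m' i)).2, (p.2.1 : EuclideanSpace ℝ d)⟫_ℝ 0 *
          (Alexander.good (Torus.geometry d) ε).indicator (fun w =>
            ((Alexander.regFlow (Torus.geometry d) ε (p.2.2) '' B).indicator (1 : Config k d (UnitAddTorus d) → ℝ) (w ∘ Fin.castAdd (m' + 1)) -
              (Alexander.regFlow (Torus.geometry d) ε (p.2.2) '' B).indicator (1 : Config k d (UnitAddTorus d) → ℝ) (collidePair (Torus.geometry d) (Fin.castAdd (m' + 1) i) (Fin.natAdd k (Fin.last m')) w ∘ Fin.castAdd (m' + 1))) *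
            W (Alexander.regFlow (Torus.geometry d) ε (-p.2.2) w)) (lossConfig (Torus.geometry d) ε p.1.1 (Fin.castAdd m' i) p.2.1 p.1.2) ∂((((volume : Measure (Config (k + m') d (UnitAddTorus d))).prod (volume : Measure (EuclideanSpace ℝ d))).prod ((((volume : Measure (EuclideanSpace ℝ d)).toSphere).prod ((volume : Measure ℝ).restrict (Ioc 0 t))))))| := by
    intro m
    calc _ ≤ |((∫ z₀ in Alexander.good (Torus.geometry d) ε,
          (Alexander.regFlow (Torus.geometry d) ε (t) '' B).indicator (1 : Config k d (UnitAddTorus d) → ℝ) (Alexander.regFlow (Torus.geometry d) ε (t) z₀ ∘ Fin.castAdd (m' + 1)) * W z₀) -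
        ∫ z₀ in Alexander.good (Torus.geometry d) ε, (Alexander.regFlow (Torus.geometry d) ε (0) '' B).indicator (1 : Config k d (UnitAddTorus d) → ℝ) (z₀ ∘ Fin.castAdd (m' + 1)) * W z₀) -
      (m' + 1 : ℝ) * ∑ i : Fin k, ∫ p, ε ^ (Fintype.card d - 1) * max ⟪p.1.2 - (p.1.1 (Fin.castAdd m' i)).2, (p.2.1 : EuclideanSpace ℝ d)⟫_ℝ 0 *
          {v : EuclideanSpace ℝ d | ‖v - (p.1.1 (Fin.castAdd m' i)).2‖ ≤ (m : ℝ)}.indicator (1 : EuclideanSpace ℝ d → ℝ) p.1.2 *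
          (Alexander.good (Torus.geometry d) ε).indicator (fun w =>
            ((Alexander.regFlow (Torus.geometry d) ε (p.2.2) '' B).indicator (1 : Config k d (UnitAddTorus d) → ℝ) (w ∘ Fin.castAdd (m' + 1)) -
              (Alexander.regFlow (Torus.geometry d) ε (p.2.2) '' B).indicator (1 : Config k d (UnitAddTorus d) → ℝ) (collidePair (Torus.geometry d) (Fin.castAdd (m' + 1) i) (Fin.natAdd k (Fin.last m')) w ∘ Fin.castAdd (m' + 1))) *
            W (Alexander.regFlow (Torus.geometry d) ε (-p.2.2) w)) (lossConfig (Torus.geometry d) ε p.1.1 (Fin.castAdd m' i) p.2.1 p.1.2) ∂((((volume : Measure (Config (k + m') d (UnitAddTorus d))).prod (volume : Measure (EuclideanSpace ℝ d))).prod ((((volume : Measure (EuclideanSpace ℝ d)).toSphere).prod ((volume : Measure ℝ).restrict (Ioc 0 t))))))| +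
        |(m' + 1 : ℝ) * ∑ i : Fin k, ∫ p, ε ^ (Fintype.card d - 1) * max ⟪p.1.2 - (p.1.1 (Fin.castAdd m' i)).2, (p.2.1 : EuclideanSpace ℝ d)⟫_ℝ 0 *
          {v : EuclideanSpace ℝ d | ‖v - (p.1.1 (Fin.castAdd m' i)).2‖ ≤ (m : ℝ)}.indicator (1 : EuclideanSpace ℝ d → ℝ) p.1.2 *
          (Alexander.good (Torus.geometry d) ε).indicator (fun w =>
            ((Alexander.regFlow (Torus.geometry d) ε (p.2.2) '' B).indicator (1 : Config k d (UnitAddTorus d) → ℝ) (w ∘ Fin.castAdd (m' + 1)) -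
              (Alexander.regFlow (Torus.geometry d) ε (p.2.2) '' B).indicator (1 : Config k d (UnitAddTorus d) → ℝ) (collidePair (Torus.geometry d) (Fin.castAdd (m' + 1) i) (Fin.natAdd k (Fin.last m')) w ∘ Fin.castAdd (m' + 1))) *
            W (Alexander.regFlow (Torus.geometry d) ε (-p.2.2) w)) (lossConfig (Torus.geometry d) ε p.1.1 (Fin.castAdd m' i) p.2.1 p.1.2) ∂((((volume : Measure (Config (k + m') d (UnitAddTorus d))).prod (volume : Measure (EuclideanSpace ℝ d))).prod ((((volume : Measure (EuclideanSpace ℝ d)).toSphere).prod ((volume : Measure ℝ).restrict (Ioc 0 t)))))) -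
          (m' + 1 : ℝ) * ∑ i : Fin k, ∫ p, ε ^ (Fintype.card d - 1) * max ⟪p.1.2 - (p.1.1 (Fin.castAdd m' i)).2, (p.2.1 : EuclideanSpace ℝ d)⟫_ℝ 0 *
          (Alexander.good (Torus.geometry d) ε).indicator (fun w =>
            ((Alexander.regFlow (Torus.geometry d) ε (p.2.2) '' B).indicator (1 : Config k d (UnitAddTorus d) → ℝ) (w ∘ Fin.castAdd (m' + 1)) -
              (Alexander.regFlow (Torus.geometry d) ε (p.2.2) '' B).indicator (1 : Config k d (UnitAddTorus d) → ℝ) (collidePair (Torus.geometry d) (Fin.castAdd (m' + 1) i) (Fin.natAdd k (Fin.last m')) w ∘ Fin.castAdd (m' + 1))) *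
            W (Alexander.regFlow (Torus.geometry d) ε (-p.2.2) w)) (lossConfig (Torus.geometry d) ε p.1.1 (Fin.castAdd m' i) p.2.1 p.1.2) ∂((((volume : Measure (Config (k + m') d (UnitAddTorus d))).prod (volume : Measure (EuclideanSpace ℝ d))).prod ((((volume : Measure (EuclideanSpace ℝ d)).toSphere).prod ((volume : Measure ℝ).restrict (Ioc 0 t))))))| := abs_sub_le _ _ _
      _ ≤ _ := by linarith [hcut m]
  have hfinal := ge_of_tendsto hR (Filter.Eventually.of_forall hle)
  rw [mul_zero, Finset.sum_const_zero, mul_zero, mul_zero, zero_add, sub_self, abs_zero] at hfinal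
  have h0 := abs_nonpos_iff.1 hfinal
  linarith [h0]

end NoCutoff


end Kinetic

end

end Literature.MathematicalPhysics.KineticTheory
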